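import Literature.Probability.LatticeModels.FermionicObservable
import Literature.Probability.LatticeModels.ExplorationWinding
import Literature.Probability.RandomPlanarGeometry.ImaginaryGeometryHarmonic
import Literature.Probability.RandomPlanarGeometry.SAWTiles
import HarnessLib

/-!
# The `κ`-dressed imaginary-geometry edge data of an explored lattice Dobrushin domain

Topic `Literature/Probability/RandomPlanarGeometry`; definition request `defn-flowLineEdgeData` of
route `CriticalPhenomena/SAWScalingLimit/SAWImaginaryGeometry` (crux `FlowLineMeanValue`, item
stmt-CriticalPhenomena-6979), companion of the edge-data Dirichlet extension
`Literature.Probability.LatticeModels.slitEdgeDirichletExtension` (`SlitEdgeDirichlet.lean`), whose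
input format `g : Site 2 → Site 2 → ℝ` (datum `g v w` of the boundary edge from the interior vertex
`v` to the exterior neighbour `w`) is the output format here.

## The object

Data: a real coefficient `s` (the "dressing", `s = (4 - κ)/4`: `1/3` for the self-avoiding walk
`κ = 8/3`; controls `0` = harmonic explorer `κ = 4`, `1/4` = Ising `κ = 3`, `1/2` = loop-erased walk
`κ = 2`); a lattice domain `U ⊆ ℤ² = Site 2` (intended finite and simply connected); marked sites
`a ∈ U` with an exterior neighbour `a⁻ ∉ U` (the curve enters at `a` with the inward normal
`a - a⁻`) and `b ∈ U` with an exterior neighbour `b⁺ ∉ U` (the target); and an explored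
self-avoiding lattice path `η = [η₀ = a, η₁, …, η_k]` in `U`. Output:
`flowLineEdgeData s U a⁻ a b b⁺ η : Site 2 → Site 2 → ℝ`, the datum `d(v → w)` of an interior
vertex `v ∈ U ∖ η` towards a lattice neighbour `w ∉ U ∖ η`, in the frame-free "`H`-normalisation"
`H = arg (g_t - W_t) + s · arg g_t'` of the route:

  `d(v → w) = c - s · θ`,

where `θ` is the angle of the counter-clockwise boundary tangent `i (w - v)` of the edge (angles
counter-clockwise from the positive `x`-axis), LIFTED continuously along the boundary of `U ∖ η`
traversed counter-clockwise (domain on the left), and `c = 0` on the right boundary arc `(a b)` and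
on the right bank of `η`, `c = π` on the left arc `(b a)` and on the left bank.  Concretely:

* **Arcs** (`w ∉ U`, `FlowLine.arcDatum`). The directed boundary edges `(v, k)` (`v ∈ U`,
  `v + e_k ∉ U`, tangent `e_{k+1} = i e_k`) of `U` are traversed counter-clockwise from the start
  edge `(a → a⁻)` by the successor map `FlowLine.bdNext U` (turn left at a convex corner, go
  straight, or turn right at a concave corner); `FlowLine.bdLift` accumulates the signed quarter
  turns, anchored so that the tangent angle of `(a → a⁻)` is `θ₀ - π/2`, `θ₀ = arg (a - a⁻)` the
  heading of the inward normal at `a`.  Edges met BEFORE the far edge `(b → b⁺)` form the right arc: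
  `d = -s θ`; edges met AFTER it form the left arc, whose lift "backwards from `a`" is the forward
  lift minus the total turning `2π` of the boundary: `d = π - s (θ - 2π)` (the `2π` lift defect
  sits at `b`).  The two defect edges carry the mean of their one-sided values: the far edge
  `(b → b⁺)` gets `π/2 - s (θ_b - π)` (`= π/2` in every left-right symmetric situation, e.g. the
  edge above `b` in the test box) and the start edge `(a → a⁻)` — only ever queried when nothing is
  explored, `η = []` — gets `π/2 - s (θ₀ - π/2)`, the same harmonic-explorer mid-value as the cap of
  a tip (below).
* **Banks** (`w = η_j ∈ η`, `FlowLine.bankDatum`), read locally: `d_in = η_j - η_{j-1}`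
  (`η_{-1} := a⁻`), `d_out = η_{j+1} - η_j`, `θ_j` = the lifted heading of `d_in`
  `= arg d_in(0) + winding (a⁻, η₀, …, η_j)` (`FlowLine.pathHeading`; the bridge to
  `Literature.Probability.LatticeModels.winding` is `FlowLine.winding_map_toComplex`).  With
  `t = i (w - v)` the tangent: `t = d_in` ⇒ left bank, `d = π - s θ_j`; `t = d_out` ⇒ left bank,
  `d = π - s θ_{j+1}`; `t = -d_in` ⇒ right bank, `d = s (π - θ_j)`; `t = -d_out` ⇒ right bank,
  `d = s (π - θ_{j+1})`; at the tip `η_k` (no `d_out`) the cap edge `v = η_k + d_in` gets the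
  harmonic-explorer mid-value `d = π/2 - s (θ_k - π/2)` (the mean of the two bank values).

Everything is in quarter turns: lattice headings are `cornerUnit k = i^k` (`k : Fin 4`), lifted
angles are `(π/2) · q` with `q : ℤ`, `arg` of the four unit vectors is `FlowLine.argQuarter`
(`0, 1, 2, -1` quarter turns, `FlowLine.arg_toComplex_cornerUnit`), and the turn between consecutive
headings is `FlowLine.qturn ∈ {0, 1, -1}` (`2` for a reversal, matching `arg (-1) = π`;
`FlowLine.turning_eq_qturn`).

## Continuum dictionary (Miller–Sheffield)

With `𝔥 = λ - (2λ/π) d` (`FlowLine.igHeight`), `λ = π/√κ = igLambda κ`, `χ = igChi κ`,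
`λ' = igLambdaPrime κ` and `s = (4 - κ)/4 = πχ/(2λ)` (`FlowLine.dressing_eq`): the right/left arc
data `-sθ` / `π - sθ` become `λ + χθ` / `-λ + χθ` (`∓λ` plus `χ` times the boundary turning — the
coordinate-change rule `h ∘ φ - χ arg φ'`), and the right/left bank data `s(π - θ)` / `π - sθ` become
`λ' + χ(θ - π/2)` / `-λ' + χ(θ - π/2)`: Miller–Sheffield's flow-line boundary values `λ'` (right
side), `-λ'` (left side) plus `χ ·` winding for a curve leaving `a` along the normal `θ₀ = π/2`
(*Imaginary geometry I*, PTRF 164 (2016), arXiv:1201.1496, Thm. 1.1, §1.2 and Fig. 1.10: "one has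
`−λ` and `λ` along the left and right sides of the axis and along the path one has `−λ'` plus the
winding on the left and `λ'` plus the winding on the right ... Each time the path makes a quarter
turn to the left, heights go up by `(π/2)χ`"; and "the correction `−χ arg f_t'` ... is the harmonic
extension of `χ` times the winding of `∂(ℍ ∖ η([0,τ]))`"), and with `s = 0` (no winding terms) the
arc data `0 / π` are, under `h = 1 - d/π`, the harmonic-explorer data `1 / 0` on the positively /
negatively oriented boundary arcs from the starting point (Schramm–Sheffield, Ann. Probab. 33 (2005),
§3.1).
These identities are `FlowLine.igHeight_rightArc/leftArc/rightBank/leftBank`.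

## Test instance (route header, "TEST")

The box `U = {-N..N} × {0..2N}` (`FlowLine.testBox N`), `a = (0,0)`, `a⁻ = (0,-1)` (so `θ₀ = π/2`, anchor tangent `0`),
`b = (0, 2N)`, `b⁺ = (0, 2N+1)`: the counter-clockwise traversal runs east along the bottom
(`θ = 0`, `d = 0`), north up the right wall (`θ = π/2`, `d = -sπ/2`), west along the top (`θ = π`,
`d = -sπ` right of `b`, `π/2` above `b`, then `θ = -π`, `d = π + sπ` left of `b`), south down the
left wall (`θ = -π/2`, `d = π + sπ/2`) and east along the bottom left half (`θ = 0`, `d = π`) —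
the values listed in the route, PROVED here for every `N` and every explored path inside the box:
`flowLineEdgeData_box_bottom_right` (`0`), `_box_right` (`-sπ/2`), `_box_top_right` (`-sπ`),
`_box_top_mid` (`π/2` above `b`), `_box_top_left` (`π + sπ`), `_box_left` (`π + sπ/2`),
`_box_bottom_left` (`π`), from the explicit traversal `FlowLine.bdEdge_box` (the boundary cycle
`FlowLine.boxEdge`, period `8N + 4`, `FlowLine.bdEdge_box_period`), its injectivity on a period
(`FlowLine.boxEdge_injOn`, whence the first-passage times `FlowLine.find_bdEdge_box`) and the lift
`FlowLine.bdLift_box` (`0, 1, 2, 3, 4` quarter turns on the five straight pieces).  The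
`x ↦ -x` symmetry `d ↦ π - d` of the rule (reflection swaps the right and left arcs and banks and
negates lifted angles, `θ₀ ↦ π - θ₀`) is visible on these seven values (`0 ↔ π`,
`-sπ/2 ↔ π + sπ/2`, `-sπ ↔ π + sπ`, `π/2` fixed) and on the local reading at the start
(`π - sπ/2 ↔ sπ/2`, cap `π/2` fixed), and is PROVED for the bank and cap data of every lattice path
without reversals whose phantom first step does not point south (`FlowLine.pathHeading_reflectX`:
`θ_j ↦ π - θ_j`; `FlowLine.bankDatum_reflectX_left`, `FlowLine.bankDatum_reflectX_cap`: `d ↦ π - d`;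
for a south start `arg ∈ (-π, π]` shifts the reflected anchor by `2π`); the arc version (reversal of
the boundary cycle of a general domain) is not included.

## Junk conventions

`flowLineEdgeData` is total: `0` on pairs `(v, w)` that are neither a bank edge (`w ∈ η`) nor a
directed boundary edge of `U` on the traversal from `(a → a⁻)` (in particular on boundaries of
holes or of other components, and for non-neighbours); non-unit vectors have heading `0`
(`FlowLine.headingOf`); a vertex occurring twice in `η` is read at its first occurrence; if
`(b → b⁺)` is not met by the traversal every edge but the start edge counts as "left arc".  The
Dirichlet extension only queries `g v (v + e_k)` for `v ∈ U ∖ η`, `v + e_k ∉ U ∖ η`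
(`isSlitEdgeDirichletSolution_congr`), where none of this matters for genuine data (`η` a
self-avoiding path in `U` from `a`, `U` simply connected and `4`-connected).

## References

* J. Miller, S. Sheffield, *Imaginary geometry I: interacting SLEs*, Probab. Theory Related Fields
  164 (2016) 553–705, arXiv:1201.1496: Thm. 1.1, §1.2 and Fig. 1.9–1.10 (boundary data `∓λ`,
  `∓λ' + χ·`winding; `λ = π/√κ`, `λ' = π√κ/4`, `χ = 2/√κ - √κ/2`; `−χ arg f_t'` = harmonic extension
  of `χ` times the winding of the boundary). [MillerSheffield2016]
* O. Schramm, S. Sheffield, *Harmonic explorer and its convergence to SLE₄*, Ann. Probab. 33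
  (2005) 2127–2148, §3.1 (the `s = 0` case: data `1` on the positively oriented arc from the start,
  `0` on the negatively oriented arc; the explorer reads the discrete harmonic extension at the tip).
  [SchrammSheffield2005]
* The mean-value conventions at the cap of the tip, at the start edge and at the far edge are those
  of the definition request (D2 of the route below); they are conventions, not cited facts.
* Route file `Summits/CriticalPhenomena/SAWScalingLimit/Theses/SAWImaginaryGeometry.lean`, header
  §§ "DEFINITION REQUESTS" (D2) and "TEST instance".
-/

noncomputable section

open scoped Classical NNReal
open Literature.Probability.LatticeModels Real

namespace Literature.Probability.RandomPlanarGeometry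

namespace FlowLine

/-! ### Headings and quarter turns -/

/-- The heading of a lattice vector: the `k : Fin 4` with `d = cornerUnit k` (`0, 1, 2, 3` = east,
north, west, south); junk `0` if `d` is not one of the four unit vectors. [folklore] -/
def headingOf (d : Site 2) : Fin 4 :=
  if d = cornerUnit 1 then 1 else if d = cornerUnit 2 then 2 else if d = cornerUnit 3 then 3 else 0

/-- `headingOf` inverts `cornerUnit`. [folklore] -/
@[simp] theorem headingOf_cornerUnit (k : Fin 4) : headingOf (cornerUnit k) = k := by
  fin_cases k <;> simp [headingOf, cornerUnit_injective.eq_iff]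

/-- `Complex.arg ∈ (-π, π]` of the unit vector `cornerUnit k`, in quarter turns: east `0`, north `1`,
west `2`, south `-1`. [folklore] -/
def argQuarter : Fin 4 → ℤ
  | 0 => 0
  | 1 => 1
  | 2 => 2
  | 3 => -1

/-- `arg (i^k) = (π/2) · argQuarter k`. [folklore] -/
theorem arg_toComplex_cornerUnit (k : Fin 4) :
    Complex.arg (Site.toComplex (cornerUnit k)) = (π / 2) * argQuarter k := by
  rw [toComplex_cornerUnit]
  fin_cases k
  · simp [argQuarter]
  · simp [argQuarter, Complex.arg_I]
  · simp [argQuarter, Complex.arg_neg_one]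
  · have h3 : Complex.I ^ 3 = -Complex.I := by
      rw [pow_succ, Complex.I_sq]; ring
    simp [argQuarter, h3, Complex.arg_neg_I]

/-- The signed quarter turn from heading `k` to heading `k'`: `0` (straight on), `+1` (left turn),
`-1` (right turn); a reversal `k' = k + 2` counts `+2` (`arg (-1) = π`). [folklore] -/
def qturn (k k' : Fin 4) : ℤ :=
  if k' = k then 0 else if k' = k + 1 then 1 else if k' = k + 3 then -1 else 2

/-- No turn. [folklore] -/
@[simp] theorem qturn_self (k : Fin 4) : qturn k k = 0 := by simp [qturn]

/-- A left turn. [folklore] -/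
@[simp] theorem qturn_add_one (k : Fin 4) : qturn k (k + 1) = 1 := by
  fin_cases k <;> simp [qturn]

/-- A right turn. [folklore] -/
@[simp] theorem qturn_add_three (k : Fin 4) : qturn k (k + 3) = -1 := by
  fin_cases k <;> simp [qturn]

/-- **Lattice turns are quarter turns**: the turning angle (`Literature.Probability.LatticeModels.turning`,
`arg` of the ratio of the outgoing to the incoming increment) of two consecutive unit lattice steps
of headings `k`, `k'` is `(π/2) · qturn k k'`. [folklore] -/
theorem turning_eq_qturn (z : ℂ) (k k' : Fin 4) :
    turning z (z + Site.toComplex (cornerUnit k))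
        (z + Site.toComplex (cornerUnit k) + Site.toComplex (cornerUnit k')) =
      (π / 2) * qturn k k' := by
  rw [turning]
  have hq : (z + Site.toComplex (cornerUnit k) + Site.toComplex (cornerUnit k') -
        (z + Site.toComplex (cornerUnit k))) / (z + Site.toComplex (cornerUnit k) - z) =
      Site.toComplex (cornerUnit k') / Site.toComplex (cornerUnit k) := by
    congr 1 <;> ring
  rw [hq, toComplex_cornerUnit, toComplex_cornerUnit]
  have h3 : Complex.I ^ 3 = -Complex.I := by rw [pow_succ, Complex.I_sq]; ring
  fin_cases k <;> fin_cases k' <;>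
    simp [qturn, h3, Complex.arg_I, Complex.arg_neg_I, Complex.arg_neg_one, div_neg, neg_div]

/-- The headings of the consecutive steps of a list of sites (`[p₀, …, pₙ] ↦ [heading (p₁ - p₀), …,
heading (pₙ - pₙ₋₁)]`). [folklore] -/
def stepDirs : List (Site 2) → List (Fin 4)
  | p :: q :: rest => headingOf (q - p) :: stepDirs (q :: rest)
  | _ => []

/-- The total signed quarter turning of a list of headings: `Σᵢ qturn kᵢ kᵢ₊₁`. [folklore] -/
def turnSum : List (Fin 4) → ℤ
  | k :: k' :: ks => qturn k k' + turnSum (k' :: ks)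
  | _ => 0

/-- `stepDirs` on two or more points. [folklore] -/
@[simp] theorem stepDirs_cons_cons (p q : Site 2) (rest : List (Site 2)) :
    stepDirs (p :: q :: rest) = headingOf (q - p) :: stepDirs (q :: rest) := rfl

/-- `stepDirs` of a single point. [folklore] -/
@[simp] theorem stepDirs_singleton (p : Site 2) : stepDirs [p] = [] := rfl

/-- `stepDirs` of no point. [folklore] -/
@[simp] theorem stepDirs_nil : stepDirs [] = [] := rfl

/-- `turnSum` on two or more headings. [folklore] -/
@[simp] theorem turnSum_cons_cons (k k' : Fin 4) (ks : List (Fin 4)) :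
    turnSum (k :: k' :: ks) = qturn k k' + turnSum (k' :: ks) := rfl

/-- `turnSum` of a single heading. [folklore] -/
@[simp] theorem turnSum_singleton (k : Fin 4) : turnSum [k] = 0 := rfl

/-- `turnSum` of no heading. [folklore] -/
@[simp] theorem turnSum_nil : turnSum [] = 0 := rfl

/-- A lattice path: consecutive sites differ by one of the four unit vectors. [folklore] -/
def IsLatticePath : List (Site 2) → Prop
  | p :: q :: rest => (∃ k, q = p + cornerUnit k) ∧ IsLatticePath (q :: rest)
  | _ => True

/-- `stepDirs` of a lattice path starting with the step `e_k`. [folklore] -/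
theorem stepDirs_cons_add (p : Site 2) (k : Fin 4) (rest : List (Site 2)) :
    stepDirs (p :: (p + cornerUnit k) :: rest) = k :: stepDirs ((p + cornerUnit k) :: rest) := by
  simp

/-- `Site.toComplex` is additive (local copy of `Literature.Probability.Percolation.toComplex_add` of
`LatticeTraceGeometry.lean`, not imported to keep this file light, as in `ExplorationWinding.lean`).
[folklore] -/
private theorem toComplex_add_site (x y : Site 2) :
    Site.toComplex (x + y) = Site.toComplex x + Site.toComplex y := by
  apply Complex.ext <;> simp [Site.toComplex]

/-- **The winding of a lattice polyline is `π/2` times its signed quarter turning**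
(`Literature.Probability.LatticeModels.winding` of the points versus `turnSum` of the headings).
[folklore] -/
theorem winding_map_toComplex :
    ∀ l : List (Site 2), IsLatticePath l →
      winding (l.map Site.toComplex) = (π / 2) * turnSum (stepDirs l)
  | [], _ => by simp
  | [p], _ => by simp
  | [p, q], _ => by simp
  | p :: q :: r :: rest, h => by
    obtain ⟨⟨k, rfl⟩, hqr⟩ := h
    obtain ⟨⟨k', rfl⟩, hrest⟩ := hqr
    have ih := winding_map_toComplex ((p + cornerUnit k) :: (p + cornerUnit k + cornerUnit k') :: rest)
      ⟨⟨k', rfl⟩, hrest⟩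
    rw [stepDirs_cons_add] at ih
    simp only [List.map_cons] at ih ⊢
    rw [winding_cons_cons_cons, ih, stepDirs_cons_add, stepDirs_cons_add, turnSum_cons_cons]
    simp only [toComplex_add_site]
    rw [turning_eq_qturn]
    push_cast
    ring

/-- Turning angles are invariant under a non-zero complex scaling (in particular under the mesh
scaling `z ↦ δz` and under rotations). [folklore] -/
theorem turning_mul_left {c : ℂ} (hc : c ≠ 0) (z₁ z₂ z₃ : ℂ) :
    turning (c * z₁) (c * z₂) (c * z₃) = turning z₁ z₂ z₃ := by
  rw [turning, turning, ← mul_sub, ← mul_sub, mul_div_mul_left _ _ hc]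

/-- The winding of a polyline is invariant under a non-zero complex scaling. [folklore] -/
theorem winding_map_mul_left {c : ℂ} (hc : c ≠ 0) :
    ∀ l : List ℂ, winding (l.map (c * ·)) = winding l
  | [] => by simp
  | [_] => by simp
  | [_, _] => by simp
  | z₁ :: z₂ :: z₃ :: rest => by
    have ih := winding_map_mul_left hc (z₂ :: z₃ :: rest)
    simp only [List.map_cons] at ih ⊢
    rw [winding_cons_cons_cons, winding_cons_cons_cons, turning_mul_left hc, ih]

/-- **The winding of a lattice polyline at mesh `δ ≠ 0`** (the polyline
`Literature.Probability.LatticeModels.meshPoint δ` of the sites, as in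
`Literature.Probability.RandomPlanarGeometry.SAW.DomainSAW.winding`) is `π/2` times its signed
quarter turning. [folklore] -/
theorem winding_map_meshPoint {δ : ℝ} (hδ : δ ≠ 0) (l : List (Site 2)) (hl : IsLatticePath l) :
    winding (l.map (meshPoint δ)) = (π / 2) * turnSum (stepDirs l) := by
  have hmap : l.map (meshPoint δ) = (l.map Site.toComplex).map ((δ : ℂ) * ·) := by
    rw [List.map_map]; rfl
  rw [hmap, winding_map_mul_left (Complex.ofReal_ne_zero.2 hδ), winding_map_toComplex l hl]

/-! ### The explored path: lifted headings and bank data -/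

/-- `θ_j` in quarter turns: the lifted heading of the `j`-th step `η_j - η_{j-1}` of the
phantom-rooted path `a⁻ :: η` (`η_{-1} = a⁻`): `argQuarter` of the first step plus the signed
quarter turns of the first `j + 1` steps. For `j` past the tip the total (junk). [folklore] -/
def pathHeadingQ (aMinus : Site 2) (η : List (Site 2)) (j : ℕ) : ℤ :=
  argQuarter ((stepDirs (aMinus :: η)).headD 0) + turnSum ((stepDirs (aMinus :: η)).take (j + 1))

/-- `θ_j = (π/2) · pathHeadingQ`: the lifted heading, in radians, of the step into `η_j`
(`= arg d_in(0) + winding (a⁻, η₀, …, η_j)`, see `pathHeading_eq_arg_add_winding`). [folklore] -/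
def pathHeading (aMinus : Site 2) (η : List (Site 2)) (j : ℕ) : ℝ :=
  (π / 2) * pathHeadingQ aMinus η j

/-- **The bank / tip datum** of the path vertex `w = η_j` (first occurrence) seen from the lattice
neighbour `v`, with tangent `t = i (w - v)` (heading `headingOf (w - v) + 1`), incoming step
`d_in = η_j - η_{j-1}` (`η_{-1} = a⁻`) of lifted heading `θ_j` and outgoing step `d_out = η_{j+1} - η_j`
of lifted heading `θ_{j+1}`:
`t = d_in` ⇒ `π - s θ_j` (left bank); `t = -d_in` ⇒ `s (π - θ_j)` (right bank); otherwise, if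
`η_j` is not the tip, `t = d_out` ⇒ `π - s θ_{j+1}`, `t = -d_out` ⇒ `s (π - θ_{j+1})`; at the tip
the cap edge (`v = η_k + d_in`, `t = -i d_in`) gets the mid-value `π/2 - s (θ_k - π/2)`; junk `0`
otherwise (`v` on the path). [cite: MillerSheffield2016, §1.2 and Fig. 1.10 (bank values ∓λ' + χ·winding), in H-normalisation] -/
def bankDatum (s : ℝ) (aMinus : Site 2) (η : List (Site 2)) (v w : Site 2) : ℝ :=
  let j := η.idxOf w
  let hs := stepDirs (aMinus :: η)
  let kin := hs.getD j 0
  let kout := hs.getD (j + 1) 0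
  let θin := pathHeading aMinus η j
  let θout := pathHeading aMinus η (j + 1)
  let t := headingOf (w - v) + 1
  if t = kin then π - s * θin
  else if t = kin + 2 then s * (π - θin)
  else if j + 1 < η.length then
    (if t = kout then π - s * θout else if t = kout + 2 then s * (π - θout) else 0)
  else if t = kin + 3 then π / 2 - s * (θin - π / 2)
  else 0

/-- `-e_{k+1} = e_{k+3}`. [folklore] -/
theorem neg_cornerUnit_add_one (k : Fin 4) : -cornerUnit (k + 1) = cornerUnit (k + 3) := by
  fin_cases k <;> decide

/-- `-e_{k+3} = e_{k+1}`. [folklore] -/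
theorem neg_cornerUnit_add_three (k : Fin 4) : -cornerUnit (k + 3) = cornerUnit (k + 1) := by
  fin_cases k <;> decide

/-- `-e_k = e_{k+2}`. [folklore] -/
theorem neg_cornerUnit (k : Fin 4) : -cornerUnit k = cornerUnit (k + 2) := by
  fin_cases k <;> decide

/-- **Local reading, left bank.** If the step into the path vertex `w` (first occurrence `j`) has
heading `k`, its left neighbour `v = w + e_{k+1}` (`= w + i·d_in`) reads `π - s·θ_j`.
[cite: MillerSheffield2016, §1.2 and Fig. 1.10 (−λ' plus the winding on the left), H-normalised] -/
theorem bankDatum_left (s : ℝ) (aMinus : Site 2) (η : List (Site 2)) (w : Site 2) {k : Fin 4}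
    (hk : (stepDirs (aMinus :: η)).getD (η.idxOf w) 0 = k) :
    bankDatum s aMinus η (w + cornerUnit (k + 1)) w = π - s * pathHeading aMinus η (η.idxOf w) := by
  have h4 : ∀ k : Fin 4, k + 3 + 1 = k := by decide
  have ht : headingOf (w - (w + cornerUnit (k + 1))) + 1 = k := by
    rw [sub_add_cancel_left, neg_cornerUnit_add_one, headingOf_cornerUnit]; exact h4 k
  simp only [bankDatum, hk, ht, ↓reduceIte]

/-- **Local reading, right bank.** If the step into the path vertex `w` (first occurrence `j`) has
heading `k`, its right neighbour `v = w + e_{k+3}` (`= w - i·d_in`) reads `s·(π - θ_j)`.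
[cite: MillerSheffield2016, §1.2 and Fig. 1.10 (λ' plus the winding on the right), H-normalised] -/
theorem bankDatum_right (s : ℝ) (aMinus : Site 2) (η : List (Site 2)) (w : Site 2) {k : Fin 4}
    (hk : (stepDirs (aMinus :: η)).getD (η.idxOf w) 0 = k) :
    bankDatum s aMinus η (w + cornerUnit (k + 3)) w = s * (π - pathHeading aMinus η (η.idxOf w)) := by
  have h4 : ∀ k : Fin 4, k + 1 + 1 = k + 2 := by decide
  have ht : headingOf (w - (w + cornerUnit (k + 3))) + 1 = k + 2 := by
    rw [sub_add_cancel_left, neg_cornerUnit_add_three, headingOf_cornerUnit]; exact h4 k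
  have hne : k + 2 ≠ k := by fin_cases k <;> decide
  simp only [bankDatum, hk, ht, hne, ↓reduceIte]

/-- **Local reading, the cap of the tip.** If `w` is the tip of `η` (first occurrence `j`, no
`η_{j+1}`) entered with heading `k`, the site ahead `v = w + e_k` reads the mid-value
`π/2 - s·(θ_j - π/2)` (the mean of the two bank values; convention D2 of route SAWImaginaryGeometry).
[folklore] -/
theorem bankDatum_cap (s : ℝ) (aMinus : Site 2) (η : List (Site 2)) (w : Site 2) {k : Fin 4}
    (hk : (stepDirs (aMinus :: η)).getD (η.idxOf w) 0 = k) (htip : ¬ η.idxOf w + 1 < η.length) :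
    bankDatum s aMinus η (w + cornerUnit k) w = π / 2 - s * (pathHeading aMinus η (η.idxOf w) - π / 2) := by
  have h4 : ∀ k : Fin 4, k + 2 + 1 = k + 3 := by decide
  have ht : headingOf (w - (w + cornerUnit k)) + 1 = k + 3 := by
    rw [sub_add_cancel_left, neg_cornerUnit, headingOf_cornerUnit]; exact h4 k
  have hne1 : k + 3 ≠ k := by fin_cases k <;> decide
  have hne2 : k + 3 ≠ k + 2 := by fin_cases k <;> decide
  simp only [bankDatum, hk, ht, hne1, hne2, htip, ↓reduceIte]

/-! ### The boundary of a lattice domain traversed counter-clockwise -/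

/-- **The counter-clockwise successor of a directed boundary edge.** A directed boundary edge of
`S` is coded `(v, k)`: `v ∈ S`, `w = v + e_k ∉ S`; its counter-clockwise tangent (domain on the
left) is `t = i e_k = e_{k+1}`. If `v + t ∉ S` the boundary turns left around `v` (convex corner,
next edge `(v, k+1)`); else if `v + t + e_k ∉ S` it goes straight (next edge `(v + t, k)`); else it
turns right into the concave corner (next edge `(v + t + e_k, k - 1)`, whose exterior site is again
`w`). This is the boundary of the union of the closed unit squares centred at the sites of `S`, with
squares touching only at a corner NOT connected (`4`-connectivity). [folklore] -/
def bdNext (S : Set (Site 2)) (e : Site 2 × Fin 4) : Site 2 × Fin 4 :=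
  if e.1 + cornerUnit (e.2 + 1) ∉ S then (e.1, e.2 + 1)
  else if e.1 + cornerUnit (e.2 + 1) + cornerUnit e.2 ∉ S then (e.1 + cornerUnit (e.2 + 1), e.2)
  else (e.1 + cornerUnit (e.2 + 1) + cornerUnit e.2, e.2 + 3)

/-- The `n`-th directed boundary edge of the counter-clockwise traversal started at `e₀`. [folklore] -/
def bdEdge (S : Set (Site 2)) (e₀ : Site 2 × Fin 4) (n : ℕ) : Site 2 × Fin 4 :=
  (bdNext S)^[n] e₀

/-- The signed quarter turns accumulated by the traversal after `n` steps (`0` at the start edge;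
`+1` per convex corner, `-1` per concave corner). [folklore] -/
def bdLift (S : Set (Site 2)) (e₀ : Site 2 × Fin 4) : ℕ → ℤ
  | 0 => 0
  | n + 1 => bdLift S e₀ n + qturn (bdEdge S e₀ n).2 (bdEdge S e₀ (n + 1)).2

/-- `bdEdge` at `0` is the start edge. [folklore] -/
@[simp] theorem bdEdge_zero (S : Set (Site 2)) (e₀ : Site 2 × Fin 4) : bdEdge S e₀ 0 = e₀ := rfl

/-- `bdEdge` steps by `bdNext`. [folklore] -/
theorem bdEdge_succ (S : Set (Site 2)) (e₀ : Site 2 × Fin 4) (n : ℕ) :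
    bdEdge S e₀ (n + 1) = bdNext S (bdEdge S e₀ n) := by
  rw [bdEdge, bdEdge, Function.iterate_succ_apply']

/-- `bdNext` preserves directed boundary edges. [folklore] -/
theorem bdNext_mem_not_mem {S : Set (Site 2)} {e : Site 2 × Fin 4}
    (h : e.1 ∈ S ∧ e.1 + cornerUnit e.2 ∉ S) :
    (bdNext S e).1 ∈ S ∧ (bdNext S e).1 + cornerUnit (bdNext S e).2 ∉ S := by
  by_cases h1 : e.1 + cornerUnit (e.2 + 1) ∈ S
  · by_cases h2 : e.1 + cornerUnit (e.2 + 1) + cornerUnit e.2 ∈ S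
    · have h13 : ∀ k : Fin 4, cornerUnit (k + 3) = -cornerUnit (k + 1) := by
        intro k; fin_cases k <;> decide
      have hcalc : e.1 + cornerUnit (e.2 + 1) + cornerUnit e.2 + cornerUnit (e.2 + 3) =
          e.1 + cornerUnit e.2 := by
        rw [h13]; abel
      have hval : bdNext S e = (e.1 + cornerUnit (e.2 + 1) + cornerUnit e.2, e.2 + 3) := by
        simp [bdNext, h1, h2]
      rw [hval]
      refine ⟨h2, ?_⟩
      show e.1 + cornerUnit (e.2 + 1) + cornerUnit e.2 + cornerUnit (e.2 + 3) ∉ S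
      rw [hcalc]
      exact h.2
    · have hval : bdNext S e = (e.1 + cornerUnit (e.2 + 1), e.2) := by simp [bdNext, h1, h2]
      rw [hval]
      exact ⟨h1, h2⟩
  · have hval : bdNext S e = (e.1, e.2 + 1) := by simp [bdNext, h1]
    rw [hval]
    exact ⟨h.1, h1⟩

/-- Every edge of the traversal from a directed boundary edge is a directed boundary edge. [folklore] -/
theorem bdEdge_mem_not_mem {S : Set (Site 2)} {e₀ : Site 2 × Fin 4}
    (h : e₀.1 ∈ S ∧ e₀.1 + cornerUnit e₀.2 ∉ S) (n : ℕ) :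
    (bdEdge S e₀ n).1 ∈ S ∧ (bdEdge S e₀ n).1 + cornerUnit (bdEdge S e₀ n).2 ∉ S := by
  induction n with
  | zero => exact h
  | succ n ih => rw [bdEdge_succ]; exact bdNext_mem_not_mem ih

/-- **The arc datum** of the boundary edge `v → w` of `U` (`w ∉ U`), for the marked sites
`a⁻ ∉ U ∋ a`, `b ∈ U ∌ b⁺`: traverse the boundary counter-clockwise from the start edge `(a → a⁻)`;
let `n` be the first passage through `(v → w)`, `n_b` the first passage through `(b → b⁺)`, and
`θ = (π/2) (argQuarter (heading (a - a⁻)) - 1 + bdLift n)` the lifted tangent angle (anchored so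
that the tangent of the start edge is the inward normal heading `θ₀` minus `π/2`). Then:
start edge (`n = 0`): `π/2 - s θ` (mean of the two arc values); right arc (`0 < n < n_b`): `-s θ`;
far edge (`n = n_b`): `π/2 - s (θ - π)` (mean of `-sθ` and `π - s(θ - 2π)`); left arc (`n > n_b`):
`π - s (θ - 2π)` (lift continued backwards from `a`: the `2π` defect sits at `b`). Junk `0` if
`(v → w)` is not on the traversal. [cite: MillerSheffield2016, §1.2–1.3 and Fig. 1.10 (arc values ∓λ; −χ arg f_t' = harmonic extension of χ·winding of the boundary)] -/
def arcDatum (s : ℝ) (U : Set (Site 2)) (aMinus a b bPlus : Site 2) (v w : Site 2) : ℝ :=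
  let e₀ : Site 2 × Fin 4 := (a, headingOf (aMinus - a))
  let e : Site 2 × Fin 4 := (v, headingOf (w - v))
  if h : w = v + cornerUnit (headingOf (w - v)) ∧ ∃ n, bdEdge U e₀ n = e then
    let n := Nat.find h.2
    let nb := if hb : ∃ m, bdEdge U e₀ m = (b, headingOf (bPlus - b)) then Nat.find hb else 0
    let θ : ℝ := (π / 2) * (argQuarter (headingOf (a - aMinus)) - 1 + bdLift U e₀ n)
    if n = 0 then π / 2 - s * θ
    else if n < nb then -s * θ
    else if n = nb then π / 2 - s * (θ - π)
    else π - s * (θ - 2 * π)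
  else 0

end FlowLine

open FlowLine

/-- **The `κ`-dressed imaginary-geometry edge data** of the lattice Dobrushin domain
`(U; a, b)` (`a⁻`, `b⁺` the exterior neighbours marking the normal at `a` and the far edge at `b`)
with the explored self-avoiding path `η = [η₀ = a, …, η_k]` (`η = []`: nothing explored), dressing
`s` (`= (4 - κ)/4`; SAW: `1/3`): the function `g v w = d(v → w) = c - s·θ` fed to
`slitEdgeDirichletExtension (U ∖ η) g` — bank/tip data `FlowLine.bankDatum` towards path vertices
`w ∈ η`, arc data `FlowLine.arcDatum` towards exterior sites `w ∉ U` (module docstring for the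
rule, the lift and the junk conventions). [cite: MillerSheffield2016, Thm. 1.1, §1.2 and Fig. 1.10 (flow-line boundary data ∓λ, ∓λ' + χ·winding), in the H-normalisation H = arg(g_t − W_t) + s·arg g_t' of route SAWImaginaryGeometry] -/
def flowLineEdgeData (s : ℝ) (U : Set (Site 2)) (aMinus a b bPlus : Site 2) (η : List (Site 2))
    (v w : Site 2) : ℝ :=
  if w ∈ η then bankDatum s aMinus η v w else arcDatum s U aMinus a b bPlus v w

/-! ### API: unfolding -/

/-- Towards a path vertex the datum is the bank/tip datum. [folklore] -/
theorem flowLineEdgeData_of_mem (s : ℝ) (U : Set (Site 2)) (aMinus a b bPlus : Site 2)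
    {η : List (Site 2)} {v w : Site 2} (hw : w ∈ η) :
    flowLineEdgeData s U aMinus a b bPlus η v w = bankDatum s aMinus η v w := by
  simp [flowLineEdgeData, hw]

/-- Towards a site off the path the datum is the arc datum. [folklore] -/
theorem flowLineEdgeData_of_not_mem (s : ℝ) (U : Set (Site 2)) (aMinus a b bPlus : Site 2)
    {η : List (Site 2)} {v w : Site 2} (hw : w ∉ η) :
    flowLineEdgeData s U aMinus a b bPlus η v w = arcDatum s U aMinus a b bPlus v w := by
  simp [flowLineEdgeData, hw]

/-- With nothing explored the data are the arc data. [folklore] -/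
@[simp] theorem flowLineEdgeData_nil (s : ℝ) (U : Set (Site 2)) (aMinus a b bPlus : Site 2) :
    flowLineEdgeData s U aMinus a b bPlus [] = arcDatum s U aMinus a b bPlus := by
  funext v w; simp [flowLineEdgeData]

/-- The arc data do not depend on the explored path: exploring more only adds bank edges
(locality for `slitEdgeDirichletExtension_congr`). [folklore] -/
theorem flowLineEdgeData_eq_of_not_mem_of_not_mem (s : ℝ) (U : Set (Site 2))
    (aMinus a b bPlus : Site 2) {η η' : List (Site 2)} {v w : Site 2} (hw : w ∉ η) (hw' : w ∉ η') :
    flowLineEdgeData s U aMinus a b bPlus η v w = flowLineEdgeData s U aMinus a b bPlus η' v w := by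
  rw [flowLineEdgeData_of_not_mem _ _ _ _ _ _ hw, flowLineEdgeData_of_not_mem _ _ _ _ _ _ hw']

/-! ### API: local reading at the start (the route's sanity check in `ℍ`)

With `a = 0` entered from `a⁻ = (0,-1) = cornerUnit 3` (inward normal north, `θ₀ = π/2`) and only
`η = [a]` explored: the left neighbour of `a` sees the left bank `π - sπ/2`, the right neighbour the
right bank `s(π - π/2)`, the site above the tip the cap value `π/2`; i.e. heights `-λ'`, `+λ'`, `0`
(`igHeight_leftBank`, `igHeight_rightBank`, `igHeight_pi_div_two`); at `s = 1/3` the bank data are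
`5π/6` and `π/6`. -/

/-- Left of the start: left bank, `d = π - s·(π/2)`. [cite: MillerSheffield2016, §1.2 and Fig. 1.10 (−λ' plus the winding on the left)] -/
theorem flowLineEdgeData_left_of_start (s : ℝ) (U : Set (Site 2)) (b bPlus : Site 2) :
    flowLineEdgeData s U (cornerUnit 3) 0 b bPlus [0] (cornerUnit 2) 0 = π - s * (π / 2) := by
  have h1 : (0 : Site 2) - cornerUnit 3 = cornerUnit 1 := by decide
  have h2 : (0 : Site 2) - cornerUnit 2 = cornerUnit 0 := by decide
  simp [flowLineEdgeData, bankDatum, pathHeading, pathHeadingQ, h1, h2, argQuarter]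

/-- Right of the start: right bank, `d = s·(π - π/2)`. [cite: MillerSheffield2016, §1.2 and Fig. 1.10 (λ' plus the winding on the right)] -/
theorem flowLineEdgeData_right_of_start (s : ℝ) (U : Set (Site 2)) (b bPlus : Site 2) :
    flowLineEdgeData s U (cornerUnit 3) 0 b bPlus [0] (cornerUnit 0) 0 = s * (π - π / 2) := by
  have h1 : (0 : Site 2) - cornerUnit 3 = cornerUnit 1 := by decide
  have h2 : (0 : Site 2) - cornerUnit 0 = cornerUnit 2 := by decide
  simp [flowLineEdgeData, bankDatum, pathHeading, pathHeadingQ, h1, h2, argQuarter]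

/-- Above the start (the cap of the tip `η_0 = a`): the mid-value `π/2` (the mean of the two bank
values, convention D2 of route SAWImaginaryGeometry). [folklore] -/
theorem flowLineEdgeData_cap_of_start (s : ℝ) (U : Set (Site 2)) (b bPlus : Site 2) :
    flowLineEdgeData s U (cornerUnit 3) 0 b bPlus [0] (cornerUnit 1) 0 = π / 2 := by
  have h1 : (0 : Site 2) - cornerUnit 3 = cornerUnit 1 := by decide
  have h2 : (0 : Site 2) - cornerUnit 1 = cornerUnit 3 := by decide
  simp [flowLineEdgeData, bankDatum, pathHeading, pathHeadingQ, h1, h2, argQuarter]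

/-- Nothing explored: the start edge `(a → a⁻)` carries the mid-value `π/2` of the two arc values
`0` (right) and `π` (left) (convention, as at the cap). [folklore] -/
theorem flowLineEdgeData_nil_start_edge (s : ℝ) (U : Set (Site 2)) (b bPlus : Site 2) :
    flowLineEdgeData s U (cornerUnit 3) 0 b bPlus [] 0 (cornerUnit 3) = π / 2 := by
  have h1 : (0 : Site 2) - cornerUnit 3 = cornerUnit 1 := by decide
  have hex : ∃ n, bdEdge U ((0 : Site 2), (3 : Fin 4)) n = (0, 3) := ⟨0, rfl⟩
  have hfind : Nat.find hex = 0 := (Nat.find_eq_zero hex).2 rfl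
  simp [flowLineEdgeData, arcDatum, h1, argQuarter, hex, hfind, bdLift]

/-- At the SAW dressing `s = 1/3` the two banks at the start read `5π/6` (left) and `π/6` (right).
[cite: MillerSheffield2016, §1.2 and Fig. 1.10 (∓λ' on the two sides), at κ = 8/3 in H-normalisation] -/
theorem flowLineEdgeData_banks_of_start_saw (U : Set (Site 2)) (b bPlus : Site 2) :
    flowLineEdgeData (1 / 3) U (cornerUnit 3) 0 b bPlus [0] (cornerUnit 2) 0 = 5 * π / 6 ∧
      flowLineEdgeData (1 / 3) U (cornerUnit 3) 0 b bPlus [0] (cornerUnit 0) 0 = π / 6 := by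
  rw [flowLineEdgeData_left_of_start, flowLineEdgeData_right_of_start]
  constructor <;> ring

namespace FlowLine

/-! ### API: the lifted heading is `arg` plus winding -/

/-- `stepDirs` commutes with `take` (one more point than steps). [folklore] -/
theorem stepDirs_take : ∀ (l : List (Site 2)) (j : ℕ), stepDirs (l.take (j + 1)) = (stepDirs l).take j
  | [], j => by simp [stepDirs]
  | [p], j => by cases j <;> simp [stepDirs]
  | p :: q :: rest, 0 => by simp [stepDirs]
  | p :: q :: rest, j + 1 => by
    have ih := stepDirs_take (q :: rest) j
    simp only [List.take_succ_cons] at ih ⊢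
    simp only [stepDirs, List.take_succ_cons, List.cons.injEq, true_and]
    simpa [List.take_succ_cons] using ih

/-- A lattice path stays a lattice path when truncated. [folklore] -/
theorem IsLatticePath.take : ∀ {l : List (Site 2)} (_ : IsLatticePath l) (n : ℕ), IsLatticePath (l.take n)
  | [], _, n => by simp [IsLatticePath]
  | [p], _, n => by cases n <;> simp [IsLatticePath]
  | p :: q :: rest, h, 0 => by simp [IsLatticePath]
  | p :: q :: rest, h, 1 => by simp [IsLatticePath]
  | p :: q :: rest, h, n + 2 => by
    simp only [List.take_succ_cons]
    have ih := IsLatticePath.take h.2 (n + 1)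
    simp only [List.take_succ_cons] at ih
    exact ⟨h.1, ih⟩

/-- **`θ_j = arg d_in(0) + W(a⁻, η₀, …, η_j)`**: for a lattice path `a⁻ :: η` with first step of
heading `k₀`, the lifted heading of the step into `η_j` (`j < |η|`) is `arg (i^{k₀})` plus the winding
(`Literature.Probability.LatticeModels.winding`) of the polyline `a⁻, η₀, …, η_j` — the formula of
the definition request. [folklore] -/
theorem pathHeading_eq_arg_add_winding (aMinus : Site 2) (η : List (Site 2)) (k₀ : Fin 4)
    (h0 : η.head? = some (aMinus + cornerUnit k₀)) (hpath : IsLatticePath (aMinus :: η)) (j : ℕ) :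
    pathHeading aMinus η j =
      Complex.arg (Site.toComplex (cornerUnit k₀)) +
        winding (((aMinus :: η).take (j + 2)).map Site.toComplex) := by
  obtain ⟨η₀, rest, rfl⟩ : ∃ η₀ rest, η = η₀ :: rest := by
    cases η with
    | nil => simp at h0
    | cons x xs => exact ⟨x, xs, rfl⟩
  simp only [List.head?_cons, Option.some.injEq] at h0
  subst h0
  rw [winding_map_toComplex _ (hpath.take (j + 2)), arg_toComplex_cornerUnit, pathHeading,
    pathHeadingQ, show j + 2 = (j + 1) + 1 from rfl, stepDirs_take, stepDirs_cons_add]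
  simp only [List.headD_cons]
  push_cast
  ring

/-! ### API: the continuum dictionary `𝔥 = λ - (2λ/π)·d` -/

/-- The affine dictionary from the `H`-normalisation to Miller–Sheffield heights:
`𝔥 = λ - (2λ/π) · d`, `λ = igLambda κ = π/√κ`. [cite: MillerSheffield2016, Thm. 1.1 (𝔥_t = 𝔥⁰_t ∘ f_t − χ arg f_t')] -/
def igHeight (κ : ℝ≥0) (d : ℝ) : ℝ := igLambda κ - (2 * igLambda κ / π) * d

/-- `λ > 0`. [cite: MillerSheffield2016, Fig. 1.9 (λ = π/√κ)] -/
theorem igLambda_pos {κ : ℝ≥0} (hκ : 0 < κ) : 0 < igLambda κ := by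
  unfold igLambda
  exact div_pos Real.pi_pos (Real.sqrt_pos.2 (by exact_mod_cast hκ))

/-- `χ = (4 - κ)λ/(2π)`. [cite: MillerSheffield2016, Thm. 1.1 (χ) with Fig. 1.9 (λ)] -/
theorem igChi_eq {κ : ℝ≥0} (hκ : 0 < κ) : igChi κ = (4 - (κ : ℝ)) * igLambda κ / (2 * π) := by
  rw [eq_div_iff (by positivity)]
  have h := two_pi_mul_igChi hκ
  linarith

/-- **The dressing is `(4 - κ)/4 = πχ/(2λ)`** (from `2πχ = (4 - κ)λ`, `two_pi_mul_igChi`).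
[cite: MillerSheffield2016, Thm. 1.1 (χ = 2/√κ − √κ/2) with Fig. 1.9 (λ = π/√κ)] -/
theorem dressing_eq {κ : ℝ≥0} (hκ : 0 < κ) :
    (4 - (κ : ℝ)) / 4 = π * igChi κ / (2 * igLambda κ) := by
  have hl : igLambda κ ≠ 0 := (igLambda_pos hκ).ne'
  have hπ : (π : ℝ) ≠ 0 := Real.pi_ne_zero
  rw [igChi_eq hκ]
  field_simp
  ring

/-- `d = 0` (right arc at the anchor) is height `λ`. [cite: MillerSheffield2016, §1.2 and Fig. 1.10 (λ along the right side of the axis)] -/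
@[simp] theorem igHeight_zero (κ : ℝ≥0) : igHeight κ 0 = igLambda κ := by simp [igHeight]

/-- `d = π` (left arc at the anchor) is height `-λ`. [cite: MillerSheffield2016, §1.2 and Fig. 1.10 (−λ along the left side of the axis)] -/
theorem igHeight_pi (κ : ℝ≥0) : igHeight κ π = -igLambda κ := by
  have hπ : (π : ℝ) ≠ 0 := Real.pi_ne_zero
  unfold igHeight
  field_simp
  ring

/-- The mid-value `d = π/2` is height `0`. [folklore] -/
theorem igHeight_pi_div_two (κ : ℝ≥0) : igHeight κ (π / 2) = 0 := by
  have hπ : (π : ℝ) ≠ 0 := Real.pi_ne_zero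
  unfold igHeight
  field_simp
  ring

/-- **Right arc**: `d = -sθ` is height `λ + χθ` (`λ` plus `χ` times the boundary turning).
[cite: MillerSheffield2016, §1.2–1.3 and Fig. 1.10 (λ on the axis; −χ arg f_t' = harmonic extension of χ·winding of the boundary)] -/
theorem igHeight_rightArc {κ : ℝ≥0} (hκ : 0 < κ) (θ : ℝ) :
    igHeight κ (-((4 - (κ : ℝ)) / 4) * θ) = igLambda κ + igChi κ * θ := by
  have hπ : (π : ℝ) ≠ 0 := Real.pi_ne_zero
  unfold igHeight
  rw [igChi_eq hκ]
  field_simp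
  ring

/-- **Left arc**: `d = π - sθ` is height `-λ + χθ`. [cite: MillerSheffield2016, §1.2–1.3 and Fig. 1.10 (−λ on the axis; −χ arg f_t' = harmonic extension of χ·winding of the boundary)] -/
theorem igHeight_leftArc {κ : ℝ≥0} (hκ : 0 < κ) (θ : ℝ) :
    igHeight κ (π - ((4 - (κ : ℝ)) / 4) * θ) = -igLambda κ + igChi κ * θ := by
  have hπ : (π : ℝ) ≠ 0 := Real.pi_ne_zero
  unfold igHeight
  rw [igChi_eq hκ]
  field_simp
  ring

/-- **Right bank**: `d = s(π - θ)` is height `λ' + χ(θ - π/2)` — Miller–Sheffield's `λ'` plus `χ`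
times the winding of a curve started with heading `π/2` (along the inward normal).
[cite: MillerSheffield2016, §1.2 and Fig. 1.10 (λ' plus the winding on the right; heights go up by (π/2)χ per left quarter turn)] -/
theorem igHeight_rightBank {κ : ℝ≥0} (hκ : 0 < κ) (θ : ℝ) :
    igHeight κ (((4 - (κ : ℝ)) / 4) * (π - θ)) = igLambdaPrime κ + igChi κ * (θ - π / 2) := by
  have hπ : (π : ℝ) ≠ 0 := Real.pi_ne_zero
  unfold igHeight igLambdaPrime
  rw [igChi_eq hκ]
  field_simp
  ring

/-- **Left bank**: `d = π - sθ` is height `-λ' + χ(θ - π/2)`.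
[cite: MillerSheffield2016, §1.2 and Fig. 1.10 (−λ' plus the winding on the left)] -/
theorem igHeight_leftBank {κ : ℝ≥0} (hκ : 0 < κ) (θ : ℝ) :
    igHeight κ (π - ((4 - (κ : ℝ)) / 4) * θ) = -igLambdaPrime κ + igChi κ * (θ - π / 2) := by
  have hπ : (π : ℝ) ≠ 0 := Real.pi_ne_zero
  unfold igHeight igLambdaPrime
  rw [igChi_eq hκ]
  field_simp
  ring

/-- At the SAW value `κ = 8/3` the dressing is `1/3`. [folklore] -/
theorem dressing_saw : (4 - (8 / 3 : ℝ)) / 4 = 1 / 3 := by norm_num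

end FlowLine

namespace FlowLine

/-! ### The test box of the route: `U = {-N..N} × {0..2N}`, `a = (0,0)`, `a⁻ = (0,-1)`, `b = (0,2N)`, `b⁺ = (0,2N+1)` -/

open Literature.Probability.RandomPlanarGeometry.SAW (pt pt_apply_zero pt_apply_one pt_sub_pt)

/-- `pt` is injective. [folklore] -/
@[simp] theorem pt_inj {x y x' y' : ℤ} : pt x y = pt x' y' ↔ x = x' ∧ y = y' := by
  constructor
  · intro h
    exact ⟨by simpa using congrFun h 0, by simpa using congrFun h 1⟩
  · rintro ⟨rfl, rfl⟩; rfl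

/-- A step east. [folklore] -/
@[simp] theorem pt_add_cornerUnit_zero (x y : ℤ) : pt x y + cornerUnit 0 = pt (x + 1) y := by
  ext i; fin_cases i <;> simp [pt, cornerUnit]

/-- A step north. [folklore] -/
@[simp] theorem pt_add_cornerUnit_one (x y : ℤ) : pt x y + cornerUnit 1 = pt x (y + 1) := by
  ext i; fin_cases i <;> simp [pt, cornerUnit]

/-- A step west. [folklore] -/
@[simp] theorem pt_add_cornerUnit_two (x y : ℤ) : pt x y + cornerUnit 2 = pt (x - 1) y := by
  ext i; fin_cases i <;> simp [pt, cornerUnit, sub_eq_add_neg]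

/-- A step south. [folklore] -/
@[simp] theorem pt_add_cornerUnit_three (x y : ℤ) : pt x y + cornerUnit 3 = pt x (y - 1) := by
  ext i; fin_cases i <;> simp [pt, cornerUnit, sub_eq_add_neg]

/-- The four unit vectors in coordinates. [folklore] -/
theorem cornerUnit_eq_pt (k : Fin 4) :
    cornerUnit k = if k = 0 then pt 1 0 else if k = 1 then pt 0 1 else if k = 2 then pt (-1) 0 else pt 0 (-1) := by
  fin_cases k <;> (ext i; fin_cases i <;> simp [pt, cornerUnit])

/-- `heading (1,0) = 0`. [folklore] -/
@[simp] theorem headingOf_pt_one_zero : headingOf (pt 1 0) = 0 := by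
  rw [show pt 1 0 = cornerUnit 0 from (cornerUnit_eq_pt 0).symm, headingOf_cornerUnit]

/-- `heading (0,1) = 1`. [folklore] -/
@[simp] theorem headingOf_pt_zero_one : headingOf (pt 0 1) = 1 := by
  rw [show pt 0 1 = cornerUnit 1 from (cornerUnit_eq_pt 1).symm, headingOf_cornerUnit]

/-- `heading (-1,0) = 2`. [folklore] -/
@[simp] theorem headingOf_pt_neg_one_zero : headingOf (pt (-1) 0) = 2 := by
  rw [show pt (-1) 0 = cornerUnit 2 from (cornerUnit_eq_pt 2).symm, headingOf_cornerUnit]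

/-- `heading (0,-1) = 3`. [folklore] -/
@[simp] theorem headingOf_pt_zero_neg_one : headingOf (pt 0 (-1)) = 3 := by
  rw [show pt 0 (-1) = cornerUnit 3 from (cornerUnit_eq_pt 3).symm, headingOf_cornerUnit]

/-- **The test box** `{-N, …, N} × {0, …, 2N}` of the route's cheapest falsifier. [folklore] -/
def testBox (N : ℕ) : Set (Site 2) := {v | -(N : ℤ) ≤ v 0 ∧ v 0 ≤ N ∧ 0 ≤ v 1 ∧ v 1 ≤ 2 * N}

/-- Membership of a site in the box, in coordinates. [folklore] -/
@[simp] theorem pt_mem_box {N : ℕ} {x y : ℤ} :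
    pt x y ∈ testBox N ↔ -(N : ℤ) ≤ x ∧ x ≤ N ∧ 0 ≤ y ∧ y ≤ 2 * N := by
  simp [testBox]

/-- `bdNext` at a convex corner. [folklore] -/
theorem bdNext_of_not_mem {S : Set (Site 2)} {v : Site 2} {k : Fin 4} (h1 : v + cornerUnit (k + 1) ∉ S) :
    bdNext S (v, k) = (v, k + 1) := by
  simp [bdNext, h1]

/-- `bdNext` along a straight piece of boundary. [folklore] -/
theorem bdNext_of_mem_of_not_mem {S : Set (Site 2)} {v : Site 2} {k : Fin 4}
    (h1 : v + cornerUnit (k + 1) ∈ S) (h2 : v + cornerUnit (k + 1) + cornerUnit k ∉ S) :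
    bdNext S (v, k) = (v + cornerUnit (k + 1), k) := by
  simp [bdNext, h1, h2]

/-- `bdNext` at a concave corner. [folklore] -/
theorem bdNext_of_mem_of_mem {S : Set (Site 2)} {v : Site 2} {k : Fin 4}
    (h1 : v + cornerUnit (k + 1) ∈ S) (h2 : v + cornerUnit (k + 1) + cornerUnit k ∈ S) :
    bdNext S (v, k) = (v + cornerUnit (k + 1) + cornerUnit k, k + 3) := by
  simp [bdNext, h1, h2]

/-- **The counter-clockwise traversal of the box boundary**, explicitly: east along the bottom right
half (`n ≤ N`), north up the right wall (`N < n ≤ 3N+1`), west along the top (`3N+1 < n ≤ 5N+2`;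
`b` at `n = 4N+2`), south down the left wall (`5N+2 < n ≤ 7N+3`), east along the bottom left half
(`7N+3 < n ≤ 8N+4`, back at the start for `n = 8N+4`). [folklore] -/
def boxEdge (N n : ℕ) : Site 2 × Fin 4 :=
  if n ≤ N then (pt n 0, 3)
  else if n ≤ 3 * N + 1 then (pt N (n - N - 1), 0)
  else if n ≤ 5 * N + 2 then (pt (4 * N + 2 - n) (2 * N), 1)
  else if n ≤ 7 * N + 3 then (pt (-N) (7 * N + 3 - n), 2)
  else (pt (n - 8 * N - 4) 0, 3)

/-- The quarter turns accumulated along the box boundary: one per corner passed. [folklore] -/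
def boxLift (N n : ℕ) : ℤ :=
  if n ≤ N then 0
  else if n ≤ 3 * N + 1 then 1
  else if n ≤ 5 * N + 2 then 2
  else if n ≤ 7 * N + 3 then 3
  else 4

/-- `(3 : Fin 4) + 1 = 0`. [folklore] -/
@[simp] theorem fin4_three_add_one : (3 : Fin 4) + 1 = 0 := by decide

/-- `(1 : Fin 4) + 1 = 2`. [folklore] -/
@[simp] theorem fin4_one_add_one : (1 : Fin 4) + 1 = 2 := by decide

/-- `(2 : Fin 4) + 1 = 3`. [folklore] -/
@[simp] theorem fin4_two_add_one : (2 : Fin 4) + 1 = 3 := by decide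

/-- **One step of the box traversal.** [folklore] -/
theorem bdNext_boxEdge (N n : ℕ) (hn : n + 1 ≤ 8 * N + 4) :
    bdNext (testBox N) (boxEdge N n) = boxEdge N (n + 1) := by
  by_cases hA : n + 1 ≤ N
  · -- straight along the bottom right half
    have hA' : n ≤ N := by omega
    simp only [boxEdge, hA, hA', ↓reduceIte]
    rw [bdNext_of_mem_of_not_mem]
    · simp only [fin4_three_add_one, pt_add_cornerUnit_zero]
      exact Prod.ext (pt_inj.2 ⟨by omega, by omega⟩) rfl
    · simp only [fin4_three_add_one, pt_add_cornerUnit_zero, pt_mem_box]; omega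
    · simp only [fin4_three_add_one, pt_add_cornerUnit_zero, pt_add_cornerUnit_three, pt_mem_box]; omega
  by_cases hAB : n = N
  · -- the bottom right corner: turn left
    have h1 : n ≤ N := by omega
    have h2 : ¬ (n + 1 ≤ N) := by omega
    have h3 : n + 1 ≤ 3 * N + 1 := by omega
    simp only [boxEdge, h1, h2, h3, ↓reduceIte]
    rw [bdNext_of_not_mem]
    · simp only [fin4_three_add_one]
      exact Prod.ext (pt_inj.2 ⟨by omega, by omega⟩) rfl
    · simp only [fin4_three_add_one, pt_add_cornerUnit_zero, pt_mem_box]; omega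
  by_cases hB : n + 1 ≤ 3 * N + 1
  · -- straight up the right wall
    have h1 : ¬ n ≤ N := by omega
    have h2 : n ≤ 3 * N + 1 := by omega
    have h3 : ¬ (n + 1 ≤ N) := by omega
    simp only [boxEdge, h1, h2, h3, hB, ↓reduceIte]
    rw [bdNext_of_mem_of_not_mem]
    · simp only [zero_add, pt_add_cornerUnit_one]
      exact Prod.ext (pt_inj.2 ⟨by omega, by omega⟩) rfl
    · simp only [zero_add, pt_add_cornerUnit_one, pt_mem_box]; omega
    · simp only [zero_add, pt_add_cornerUnit_one, pt_add_cornerUnit_zero, pt_mem_box]; omega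
  by_cases hBC : n = 3 * N + 1
  · -- the top right corner: turn left
    have h1 : ¬ n ≤ N := by omega
    have h2 : n ≤ 3 * N + 1 := by omega
    have h3 : ¬ (n + 1 ≤ N) := by omega
    have h4 : ¬ (n + 1 ≤ 3 * N + 1) := by omega
    have h5 : n + 1 ≤ 5 * N + 2 := by omega
    simp only [boxEdge, h1, h2, h3, h4, h5, ↓reduceIte]
    rw [bdNext_of_not_mem]
    · simp only [zero_add]
      exact Prod.ext (pt_inj.2 ⟨by omega, by omega⟩) rfl
    · simp only [zero_add, pt_add_cornerUnit_one, pt_mem_box]; omega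
  by_cases hC : n + 1 ≤ 5 * N + 2
  · -- straight along the top, westwards
    have h1 : ¬ n ≤ N := by omega
    have h2 : ¬ n ≤ 3 * N + 1 := by omega
    have h3 : n ≤ 5 * N + 2 := by omega
    have h4 : ¬ (n + 1 ≤ N) := by omega
    have h5 : ¬ (n + 1 ≤ 3 * N + 1) := by omega
    simp only [boxEdge, h1, h2, h3, h4, h5, hC, ↓reduceIte]
    rw [bdNext_of_mem_of_not_mem]
    · simp only [fin4_one_add_one, pt_add_cornerUnit_two]
      exact Prod.ext (pt_inj.2 ⟨by omega, by omega⟩) rfl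
    · simp only [fin4_one_add_one, pt_add_cornerUnit_two, pt_mem_box]; omega
    · simp only [fin4_one_add_one, pt_add_cornerUnit_two, pt_add_cornerUnit_one, pt_mem_box]; omega
  by_cases hCD : n = 5 * N + 2
  · -- the top left corner: turn left
    have h1 : ¬ n ≤ N := by omega
    have h2 : ¬ n ≤ 3 * N + 1 := by omega
    have h3 : n ≤ 5 * N + 2 := by omega
    have h4 : ¬ (n + 1 ≤ N) := by omega
    have h5 : ¬ (n + 1 ≤ 3 * N + 1) := by omega
    have h6 : ¬ (n + 1 ≤ 5 * N + 2) := by omega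
    have h7 : n + 1 ≤ 7 * N + 3 := by omega
    simp only [boxEdge, h1, h2, h3, h4, h5, h6, h7, ↓reduceIte]
    rw [bdNext_of_not_mem]
    · simp only [fin4_one_add_one]
      exact Prod.ext (pt_inj.2 ⟨by omega, by omega⟩) rfl
    · simp only [fin4_one_add_one, pt_add_cornerUnit_two, pt_mem_box]; omega
  by_cases hD : n + 1 ≤ 7 * N + 3
  · -- straight down the left wall
    have h1 : ¬ n ≤ N := by omega
    have h2 : ¬ n ≤ 3 * N + 1 := by omega
    have h3 : ¬ n ≤ 5 * N + 2 := by omega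
    have h4 : n ≤ 7 * N + 3 := by omega
    have h5 : ¬ (n + 1 ≤ N) := by omega
    have h6 : ¬ (n + 1 ≤ 3 * N + 1) := by omega
    have h7 : ¬ (n + 1 ≤ 5 * N + 2) := by omega
    simp only [boxEdge, h1, h2, h3, h4, h5, h6, h7, hD, ↓reduceIte]
    rw [bdNext_of_mem_of_not_mem]
    · simp only [fin4_two_add_one, pt_add_cornerUnit_three]
      exact Prod.ext (pt_inj.2 ⟨by omega, by omega⟩) rfl
    · simp only [fin4_two_add_one, pt_add_cornerUnit_three, pt_mem_box]; omega
    · simp only [fin4_two_add_one, pt_add_cornerUnit_three, pt_add_cornerUnit_two, pt_mem_box]; omega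
  by_cases hDE : n = 7 * N + 3
  · -- the bottom left corner: turn left
    have h1 : ¬ n ≤ N := by omega
    have h2 : ¬ n ≤ 3 * N + 1 := by omega
    have h3 : ¬ n ≤ 5 * N + 2 := by omega
    have h4 : n ≤ 7 * N + 3 := by omega
    have h5 : ¬ (n + 1 ≤ N) := by omega
    have h6 : ¬ (n + 1 ≤ 3 * N + 1) := by omega
    have h7 : ¬ (n + 1 ≤ 5 * N + 2) := by omega
    have h8 : ¬ (n + 1 ≤ 7 * N + 3) := by omega
    simp only [boxEdge, h1, h2, h3, h4, h5, h6, h7, h8, ↓reduceIte]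
    rw [bdNext_of_not_mem]
    · simp only [fin4_two_add_one]
      exact Prod.ext (pt_inj.2 ⟨by omega, by omega⟩) rfl
    · simp only [fin4_two_add_one, pt_add_cornerUnit_three, pt_mem_box]; omega
  · -- straight along the bottom left half
    have h1 : ¬ n ≤ N := by omega
    have h2 : ¬ n ≤ 3 * N + 1 := by omega
    have h3 : ¬ n ≤ 5 * N + 2 := by omega
    have h4 : ¬ n ≤ 7 * N + 3 := by omega
    have h5 : ¬ (n + 1 ≤ N) := by omega
    have h6 : ¬ (n + 1 ≤ 3 * N + 1) := by omega
    have h7 : ¬ (n + 1 ≤ 5 * N + 2) := by omega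
    have h8 : ¬ (n + 1 ≤ 7 * N + 3) := by omega
    simp only [boxEdge, h1, h2, h3, h4, h5, h6, h7, h8, ↓reduceIte]
    rw [bdNext_of_mem_of_not_mem]
    · simp only [fin4_three_add_one, pt_add_cornerUnit_zero]
      exact Prod.ext (pt_inj.2 ⟨by omega, by omega⟩) rfl
    · simp only [fin4_three_add_one, pt_add_cornerUnit_zero, pt_mem_box]; omega
    · simp only [fin4_three_add_one, pt_add_cornerUnit_zero, pt_add_cornerUnit_three, pt_mem_box]; omega

/-- The start edge `(a → a⁻)` of the box, `a = (0,0)`, `a⁻ = (0,-1)`, is `boxEdge N 0`. [folklore] -/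
theorem boxEdge_zero (N : ℕ) : boxEdge N 0 = (pt 0 0, 3) := by
  simp only [boxEdge, Nat.zero_le, ↓reduceIte, Nat.cast_zero]

/-- **The traversal of the box boundary from `(a → a⁻)` is `boxEdge`.** [folklore] -/
theorem bdEdge_box (N : ℕ) {n : ℕ} (hn : n ≤ 8 * N + 4) :
    bdEdge (testBox N) (pt 0 0, 3) n = boxEdge N n := by
  induction n with
  | zero => rw [bdEdge_zero, boxEdge_zero]
  | succ n ih => rw [bdEdge_succ, ih (by omega), bdNext_boxEdge N n hn]

/-- The traversal closes up after `8N + 4` edges (the perimeter of the box). [folklore] -/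
theorem bdEdge_box_period (N : ℕ) : bdEdge (testBox N) (pt 0 0, 3) (8 * N + 4) = (pt 0 0, 3) := by
  rw [bdEdge_box N le_rfl]
  have h1 : ¬ (8 * N + 4 ≤ N) := by omega
  have h2 : ¬ (8 * N + 4 ≤ 3 * N + 1) := by omega
  have h3 : ¬ (8 * N + 4 ≤ 5 * N + 2) := by omega
  have h4 : ¬ (8 * N + 4 ≤ 7 * N + 3) := by omega
  simp only [boxEdge, h1, h2, h3, h4, ↓reduceIte]
  refine Prod.ext (pt_inj.2 ⟨?_, rfl⟩) rfl
  push_cast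
  ring

/-- First coordinate along the box traversal. [folklore] -/
def boxX (N n : ℕ) : ℤ :=
  if n ≤ N then n
  else if n ≤ 3 * N + 1 then N
  else if n ≤ 5 * N + 2 then 4 * N + 2 - n
  else if n ≤ 7 * N + 3 then -N
  else n - 8 * N - 4

/-- Second coordinate along the box traversal. [folklore] -/
def boxY (N n : ℕ) : ℤ :=
  if n ≤ N then 0
  else if n ≤ 3 * N + 1 then n - N - 1
  else if n ≤ 5 * N + 2 then 2 * N
  else if n ≤ 7 * N + 3 then 7 * N + 3 - n
  else 0

/-- Outward normal heading along the box traversal, as a natural number. [folklore] -/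
def boxDirVal (N n : ℕ) : ℕ :=
  if n ≤ N then 3
  else if n ≤ 3 * N + 1 then 0
  else if n ≤ 5 * N + 2 then 1
  else if n ≤ 7 * N + 3 then 2
  else 3

/-- `boxEdge` in coordinates: first coordinate. [folklore] -/
theorem boxEdge_fst_apply_zero (N n : ℕ) : (boxEdge N n).1 0 = boxX N n := by
  unfold boxEdge boxX
  split_ifs <;> rfl

/-- `boxEdge` in coordinates: second coordinate. [folklore] -/
theorem boxEdge_fst_apply_one (N n : ℕ) : (boxEdge N n).1 1 = boxY N n := by
  unfold boxEdge boxY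
  split_ifs <;> rfl

/-- `boxEdge` in coordinates: the heading. [folklore] -/
theorem boxEdge_snd_val (N n : ℕ) : ((boxEdge N n).2 : ℕ) = boxDirVal N n := by
  unfold boxEdge boxDirVal
  split_ifs <;> rfl

/-- **The box traversal does not repeat an edge within a period.** [folklore] -/
theorem boxEdge_injOn (N : ℕ) {m n : ℕ} (hm : m < 8 * N + 4) (hn : n < 8 * N + 4)
    (h : boxEdge N m = boxEdge N n) : m = n := by
  have hx : boxX N m = boxX N n := by
    rw [← boxEdge_fst_apply_zero, ← boxEdge_fst_apply_zero, h]
  have hy : boxY N m = boxY N n := by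
    rw [← boxEdge_fst_apply_one, ← boxEdge_fst_apply_one, h]
  have hk : boxDirVal N m = boxDirVal N n := by
    rw [← boxEdge_snd_val, ← boxEdge_snd_val, h]
  simp only [boxX, boxY, boxDirVal] at hx hy hk
  split_ifs at hx hy hk <;> omega

/-- **First passage**: the traversal from `(a → a⁻)` first meets `boxEdge N n` at time `n`
(`n < 8N + 4`). [folklore] -/
theorem find_bdEdge_box (N : ℕ) {n : ℕ} (hn : n < 8 * N + 4)
    (h : ∃ m, bdEdge (testBox N) (pt 0 0, 3) m = boxEdge N n) : Nat.find h = n := by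
  rw [Nat.find_eq_iff]
  refine ⟨bdEdge_box N hn.le, fun m hm heq => ?_⟩
  rw [bdEdge_box N (by omega)] at heq
  have := boxEdge_injOn N (by omega) hn heq
  omega

/-- The heading along the box is `3 +` the number of corners passed, mod `4`. [folklore] -/
theorem boxDirVal_eq (N n : ℕ) : (boxDirVal N n : ℤ) = (3 + boxLift N n) % 4 := by
  simp only [boxDirVal, boxLift]
  split_ifs <;> omega

/-- Consecutive lifts along the box differ by `0` (straight on) or `1` (a convex corner). [folklore] -/
theorem boxLift_succ (N n : ℕ) :
    boxLift N (n + 1) = boxLift N n ∨ boxLift N (n + 1) = boxLift N n + 1 := by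
  simp only [boxLift]
  split_ifs <;> omega

/-- **The lifted quarter turns along the box**: `0, 1, 2, 3, 4` on the five straight pieces. [folklore] -/
theorem bdLift_box (N : ℕ) {n : ℕ} (hn : n ≤ 8 * N + 4) :
    bdLift (testBox N) (pt 0 0, 3) n = boxLift N n := by
  induction n with
  | zero => simp [bdLift, boxLift]
  | succ n ih =>
    rw [bdLift, ih (by omega), bdEdge_box N (by omega), bdEdge_box N hn]
    have h1 := boxDirVal_eq N n
    have h2 := boxDirVal_eq N (n + 1)
    rcases boxLift_succ N n with h | h
    · have hk : (boxEdge N (n + 1)).2 = (boxEdge N n).2 := by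
        apply Fin.ext
        rw [boxEdge_snd_val, boxEdge_snd_val]
        omega
      rw [hk, qturn_self, h, add_zero]
    · have hk : (boxEdge N (n + 1)).2 = (boxEdge N n).2 + 1 := by
        apply Fin.ext
        rw [Fin.val_add, boxEdge_snd_val, boxEdge_snd_val]
        have h4 : ((1 : Fin 4) : ℕ) = 1 := rfl
        rw [h4]
        omega
      rw [hk, qturn_add_one, h]

/-- The far edge `(b → b⁺)`, `b = (0, 2N)`, is met at time `4N + 2`. [folklore] -/
theorem boxEdge_far (N : ℕ) : boxEdge N (4 * N + 2) = (pt 0 (2 * N), 1) := by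
  have h1 : ¬ (4 * N + 2 ≤ N) := by omega
  have h2 : ¬ (4 * N + 2 ≤ 3 * N + 1) := by omega
  have h3 : 4 * N + 2 ≤ 5 * N + 2 := by omega
  simp only [boxEdge, h1, h2, h3, ↓reduceIte]
  refine Prod.ext (pt_inj.2 ⟨?_, rfl⟩) rfl
  push_cast
  ring

/-- **The arc data of the test box** along the traversal: with `θ = (π/2)·boxLift`, the start edge
`(a → a⁻)` carries `π/2 - sθ = π/2`, the right arc (`0 < n < 4N+2`) `-sθ`, the far edge above `b`
(`n = 4N+2`) `π/2 - s(θ - π) = π/2`, the left arc (`n > 4N+2`) `π - s(θ - 2π)`. [folklore] -/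
theorem arcDatum_box (s : ℝ) (N : ℕ) {n : ℕ} (hn : n < 8 * N + 4) {v : Site 2} {k : Fin 4}
    (he : boxEdge N n = (v, k)) :
    arcDatum s (testBox N) (pt 0 (-1)) (pt 0 0) (pt 0 (2 * N)) (pt 0 (2 * N + 1)) v (v + cornerUnit k) =
      if n = 0 then π / 2 - s * ((π / 2) * boxLift N n)
      else if n < 4 * N + 2 then -s * ((π / 2) * boxLift N n)
      else if n = 4 * N + 2 then π / 2 - s * ((π / 2) * boxLift N n - π)
      else π - s * ((π / 2) * boxLift N n - 2 * π) := by
  have hk : headingOf (v + cornerUnit k - v) = k := by rw [add_sub_cancel_left, headingOf_cornerUnit]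
  have h0 : headingOf (pt 0 (-1) - pt 0 0) = 3 := by simp
  have h0' : headingOf (pt 0 0 - pt 0 (-1)) = 1 := by simp
  have hb : headingOf (pt 0 (2 * N + 1) - pt 0 (2 * N)) = 1 := by simp
  have hex : ∃ m, bdEdge (testBox N) (pt 0 0, 3) m = (v, k) := ⟨n, by rw [bdEdge_box N hn.le, he]⟩
  have hexb : ∃ m, bdEdge (testBox N) (pt 0 0, 3) m = (pt 0 (2 * N), 1) :=
    ⟨4 * N + 2, by rw [bdEdge_box N (by omega), boxEdge_far]⟩
  have hfind : Nat.find hex = n := by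
    have hex' : ∃ m, bdEdge (testBox N) (pt 0 0, 3) m = boxEdge N n := by rw [he]; exact hex
    have := find_bdEdge_box N hn hex'
    convert this using 2
    rw [he]
  have hfindb : Nat.find hexb = 4 * N + 2 := by
    have hexb' : ∃ m, bdEdge (testBox N) (pt 0 0, 3) m = boxEdge N (4 * N + 2) := by
      rw [boxEdge_far]; exact hexb
    have := find_bdEdge_box N (by omega) hexb'
    convert this using 2
    rw [boxEdge_far]
  simp only [arcDatum, hk, h0, h0', hb, true_and, hex, hexb, ↓reduceDIte, hfind, hfindb,
    bdLift_box N hn.le]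
  simp [argQuarter]

/-- Sites of the box are in the box: a path `η` inside the box never contains an exterior site. [folklore] -/
theorem not_mem_of_forall_mem_box {N : ℕ} {η : List (Site 2)} (hη : ∀ z ∈ η, z ∈ testBox N) {w : Site 2}
    (hw : w ∉ testBox N) : w ∉ η := fun h => hw (hη w h)

end FlowLine

open FlowLine Literature.Probability.RandomPlanarGeometry.SAW in
/-- **Test box, below the bottom wall, right half** (`v = (j, 0)`, `0 < j ≤ N`): `d = 0`.
(The route's TEST instance.) [folklore] -/
theorem flowLineEdgeData_box_bottom_right (s : ℝ) (N : ℕ) {η : List (Site 2)}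
    (hη : ∀ z ∈ η, z ∈ testBox N) {j : ℕ} (hj : 1 ≤ j) (hjN : j ≤ N) :
    flowLineEdgeData s (testBox N) (pt 0 (-1)) (pt 0 0) (pt 0 (2 * N)) (pt 0 (2 * N + 1)) η
      (pt j 0) (pt j (-1)) = 0 := by
  have hw : pt (j : ℤ) (-1) ∉ testBox N := by simp
  rw [flowLineEdgeData_of_not_mem _ _ _ _ _ _ (not_mem_of_forall_mem_box hη hw)]
  have he : boxEdge N j = (pt j 0, 3) := by
    simp only [boxEdge, hjN, ↓reduceIte]
  have := arcDatum_box s N (n := j) (by omega) he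
  rw [pt_add_cornerUnit_three, zero_sub] at this
  rw [this]
  have h1 : j ≠ 0 := by omega
  have h2 : j < 4 * N + 2 := by omega
  simp only [h1, h2, hjN, boxLift, ↓reduceIte]
  push_cast
  ring

open FlowLine Literature.Probability.RandomPlanarGeometry.SAW in
/-- **Test box, beyond the right wall** (`v = (N, j)`, `0 ≤ j ≤ 2N`): `d = -sπ/2`.
(The route's TEST instance.) [folklore] -/
theorem flowLineEdgeData_box_right (s : ℝ) (N : ℕ) {η : List (Site 2)}
    (hη : ∀ z ∈ η, z ∈ testBox N) {j : ℕ} (hj : j ≤ 2 * N) :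
    flowLineEdgeData s (testBox N) (pt 0 (-1)) (pt 0 0) (pt 0 (2 * N)) (pt 0 (2 * N + 1)) η
      (pt N j) (pt (N + 1) j) = -(s * (π / 2)) := by
  have hw : pt ((N : ℤ) + 1) j ∉ testBox N := by simp
  rw [flowLineEdgeData_of_not_mem _ _ _ _ _ _ (not_mem_of_forall_mem_box hη hw)]
  have he : boxEdge N (N + 1 + j) = (pt N j, 0) := by
    have h1 : ¬ (N + 1 + j ≤ N) := by omega
    have h2 : N + 1 + j ≤ 3 * N + 1 := by omega
    simp only [boxEdge, h1, h2, ↓reduceIte]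
    refine Prod.ext (pt_inj.2 ⟨rfl, ?_⟩) rfl
    push_cast
    ring
  have := arcDatum_box s N (n := N + 1 + j) (by omega) he
  rw [pt_add_cornerUnit_zero] at this
  rw [this]
  have h1 : N + 1 + j ≠ 0 := by omega
  have h2 : N + 1 + j < 4 * N + 2 := by omega
  have h3 : ¬ (N + 1 + j ≤ N) := by omega
  have h4 : N + 1 + j ≤ 3 * N + 1 := by omega
  simp only [h1, h2, h3, h4, boxLift, ↓reduceIte]
  push_cast
  ring

open FlowLine Literature.Probability.RandomPlanarGeometry.SAW in
/-- **Test box, above the top wall, right of `b`** (`v = (j, 2N)`, `0 < j ≤ N`): `d = -sπ`.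
(The route's TEST instance.) [folklore] -/
theorem flowLineEdgeData_box_top_right (s : ℝ) (N : ℕ) {η : List (Site 2)}
    (hη : ∀ z ∈ η, z ∈ testBox N) {j : ℕ} (hj : 1 ≤ j) (hjN : j ≤ N) :
    flowLineEdgeData s (testBox N) (pt 0 (-1)) (pt 0 0) (pt 0 (2 * N)) (pt 0 (2 * N + 1)) η
      (pt j (2 * N)) (pt j (2 * N + 1)) = -(s * π) := by
  have hw : pt (j : ℤ) (2 * N + 1) ∉ testBox N := by simp
  rw [flowLineEdgeData_of_not_mem _ _ _ _ _ _ (not_mem_of_forall_mem_box hη hw)]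
  have he : boxEdge N (4 * N + 2 - j) = (pt j (2 * N), 1) := by
    have h1 : ¬ (4 * N + 2 - j ≤ N) := by omega
    have h2 : ¬ (4 * N + 2 - j ≤ 3 * N + 1) := by omega
    have h3 : 4 * N + 2 - j ≤ 5 * N + 2 := by omega
    simp only [boxEdge, h1, h2, h3, ↓reduceIte]
    refine Prod.ext (pt_inj.2 ⟨?_, rfl⟩) rfl
    omega
  have := arcDatum_box s N (n := 4 * N + 2 - j) (by omega) he
  rw [pt_add_cornerUnit_one] at this
  rw [this]
  have h1 : 4 * N + 2 - j ≠ 0 := by omega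
  have h2 : 4 * N + 2 - j < 4 * N + 2 := by omega
  have h3 : ¬ (4 * N + 2 - j ≤ N) := by omega
  have h4 : ¬ (4 * N + 2 - j ≤ 3 * N + 1) := by omega
  have h5 : 4 * N + 2 - j ≤ 5 * N + 2 := by omega
  simp only [h1, h2, h3, h4, h5, boxLift, ↓reduceIte]
  push_cast
  ring

open FlowLine Literature.Probability.RandomPlanarGeometry.SAW in
/-- **Test box, above `b`** (`v = b = (0, 2N)`): the far edge carries `π/2` (the route's TEST
instance: "π/2 (v.x = 0, above b)"; the mean of the one-sided values `-sπ` and `π + sπ`). [folklore] -/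
theorem flowLineEdgeData_box_top_mid (s : ℝ) (N : ℕ) {η : List (Site 2)}
    (hη : ∀ z ∈ η, z ∈ testBox N) :
    flowLineEdgeData s (testBox N) (pt 0 (-1)) (pt 0 0) (pt 0 (2 * N)) (pt 0 (2 * N + 1)) η
      (pt 0 (2 * N)) (pt 0 (2 * N + 1)) = π / 2 := by
  have hw : pt (0 : ℤ) (2 * N + 1) ∉ testBox N := by simp
  rw [flowLineEdgeData_of_not_mem _ _ _ _ _ _ (not_mem_of_forall_mem_box hη hw)]
  have := arcDatum_box s N (n := 4 * N + 2) (by omega) (boxEdge_far N)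
  rw [pt_add_cornerUnit_one] at this
  rw [this]
  have h1 : 4 * N + 2 ≠ 0 := by omega
  have h3 : ¬ (4 * N + 2 ≤ N) := by omega
  have h4 : ¬ (4 * N + 2 ≤ 3 * N + 1) := by omega
  have h5 : 4 * N + 2 ≤ 5 * N + 2 := by omega
  simp only [h1, lt_self_iff_false, h3, h4, h5, boxLift, ↓reduceIte]
  push_cast
  ring

open FlowLine Literature.Probability.RandomPlanarGeometry.SAW in
/-- **Test box, above the top wall, left of `b`** (`v = (-j, 2N)`, `0 < j ≤ N`): `d = π + sπ`.
(The route's TEST instance.) [folklore] -/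
theorem flowLineEdgeData_box_top_left (s : ℝ) (N : ℕ) {η : List (Site 2)}
    (hη : ∀ z ∈ η, z ∈ testBox N) {j : ℕ} (hj : 1 ≤ j) (hjN : j ≤ N) :
    flowLineEdgeData s (testBox N) (pt 0 (-1)) (pt 0 0) (pt 0 (2 * N)) (pt 0 (2 * N + 1)) η
      (pt (-j) (2 * N)) (pt (-j) (2 * N + 1)) = π + s * π := by
  have hw : pt (-(j : ℤ)) (2 * N + 1) ∉ testBox N := by simp
  rw [flowLineEdgeData_of_not_mem _ _ _ _ _ _ (not_mem_of_forall_mem_box hη hw)]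
  have he : boxEdge N (4 * N + 2 + j) = (pt (-j) (2 * N), 1) := by
    have h1 : ¬ (4 * N + 2 + j ≤ N) := by omega
    have h2 : ¬ (4 * N + 2 + j ≤ 3 * N + 1) := by omega
    have h3 : 4 * N + 2 + j ≤ 5 * N + 2 := by omega
    simp only [boxEdge, h1, h2, h3, ↓reduceIte]
    refine Prod.ext (pt_inj.2 ⟨?_, rfl⟩) rfl
    push_cast
    ring
  have := arcDatum_box s N (n := 4 * N + 2 + j) (by omega) he
  rw [pt_add_cornerUnit_one] at this
  rw [this]
  have h1 : 4 * N + 2 + j ≠ 0 := by omega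
  have h2 : ¬ (4 * N + 2 + j < 4 * N + 2) := by omega
  have h2' : 4 * N + 2 + j ≠ 4 * N + 2 := by omega
  have h3 : ¬ (4 * N + 2 + j ≤ N) := by omega
  have h4 : ¬ (4 * N + 2 + j ≤ 3 * N + 1) := by omega
  have h5 : 4 * N + 2 + j ≤ 5 * N + 2 := by omega
  simp only [h1, h2, h2', h3, h4, h5, boxLift, ↓reduceIte]
  push_cast
  ring

open FlowLine Literature.Probability.RandomPlanarGeometry.SAW in
/-- **Test box, beyond the left wall** (`v = (-N, j)`, `0 ≤ j ≤ 2N`): `d = π + sπ/2`.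
(The route's TEST instance.) [folklore] -/
theorem flowLineEdgeData_box_left (s : ℝ) (N : ℕ) {η : List (Site 2)}
    (hη : ∀ z ∈ η, z ∈ testBox N) {j : ℕ} (hj : j ≤ 2 * N) :
    flowLineEdgeData s (testBox N) (pt 0 (-1)) (pt 0 0) (pt 0 (2 * N)) (pt 0 (2 * N + 1)) η
      (pt (-N) j) (pt (-N - 1) j) = π + s * (π / 2) := by
  have hw : pt (-(N : ℤ) - 1) j ∉ testBox N := by simp
  rw [flowLineEdgeData_of_not_mem _ _ _ _ _ _ (not_mem_of_forall_mem_box hη hw)]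
  have he : boxEdge N (7 * N + 3 - j) = (pt (-N) j, 2) := by
    have h1 : ¬ (7 * N + 3 - j ≤ N) := by omega
    have h2 : ¬ (7 * N + 3 - j ≤ 3 * N + 1) := by omega
    have h3 : ¬ (7 * N + 3 - j ≤ 5 * N + 2) := by omega
    have h4 : 7 * N + 3 - j ≤ 7 * N + 3 := by omega
    simp only [boxEdge, h1, h2, h3, h4, ↓reduceIte]
    refine Prod.ext (pt_inj.2 ⟨rfl, ?_⟩) rfl
    omega
  have := arcDatum_box s N (n := 7 * N + 3 - j) (by omega) he
  rw [pt_add_cornerUnit_two] at this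
  rw [this]
  have h1 : 7 * N + 3 - j ≠ 0 := by omega
  have h2 : ¬ (7 * N + 3 - j < 4 * N + 2) := by omega
  have h2' : 7 * N + 3 - j ≠ 4 * N + 2 := by omega
  have h3 : ¬ (7 * N + 3 - j ≤ N) := by omega
  have h4 : ¬ (7 * N + 3 - j ≤ 3 * N + 1) := by omega
  have h5 : ¬ (7 * N + 3 - j ≤ 5 * N + 2) := by omega
  have h6 : 7 * N + 3 - j ≤ 7 * N + 3 := by omega
  simp only [h1, h2, h2', h3, h4, h5, h6, boxLift, ↓reduceIte]
  push_cast
  ring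

open FlowLine Literature.Probability.RandomPlanarGeometry.SAW in
/-- **Test box, below the bottom wall, left half** (`v = (-j, 0)`, `0 < j ≤ N`): `d = π`.
(The route's TEST instance.) [folklore] -/
theorem flowLineEdgeData_box_bottom_left (s : ℝ) (N : ℕ) {η : List (Site 2)}
    (hη : ∀ z ∈ η, z ∈ testBox N) {j : ℕ} (hj : 1 ≤ j) (hjN : j ≤ N) :
    flowLineEdgeData s (testBox N) (pt 0 (-1)) (pt 0 0) (pt 0 (2 * N)) (pt 0 (2 * N + 1)) η
      (pt (-j) 0) (pt (-j) (-1)) = π := by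
  have hw : pt (-(j : ℤ)) (-1) ∉ testBox N := by simp
  rw [flowLineEdgeData_of_not_mem _ _ _ _ _ _ (not_mem_of_forall_mem_box hη hw)]
  have he : boxEdge N (8 * N + 4 - j) = (pt (-j) 0, 3) := by
    have h1 : ¬ (8 * N + 4 - j ≤ N) := by omega
    have h2 : ¬ (8 * N + 4 - j ≤ 3 * N + 1) := by omega
    have h3 : ¬ (8 * N + 4 - j ≤ 5 * N + 2) := by omega
    have h4 : ¬ (8 * N + 4 - j ≤ 7 * N + 3) := by omega
    simp only [boxEdge, h1, h2, h3, h4, ↓reduceIte]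
    refine Prod.ext (pt_inj.2 ⟨?_, rfl⟩) rfl
    omega
  have := arcDatum_box s N (n := 8 * N + 4 - j) (by omega) he
  rw [pt_add_cornerUnit_three, zero_sub] at this
  rw [this]
  have h1 : 8 * N + 4 - j ≠ 0 := by omega
  have h2 : ¬ (8 * N + 4 - j < 4 * N + 2) := by omega
  have h2' : 8 * N + 4 - j ≠ 4 * N + 2 := by omega
  have h3 : ¬ (8 * N + 4 - j ≤ N) := by omega
  have h4 : ¬ (8 * N + 4 - j ≤ 3 * N + 1) := by omega
  have h5 : ¬ (8 * N + 4 - j ≤ 5 * N + 2) := by omega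
  have h6 : ¬ (8 * N + 4 - j ≤ 7 * N + 3) := by omega
  simp only [h1, h2, h2', h3, h4, h5, h6, boxLift, ↓reduceIte]
  push_cast
  ring


namespace FlowLine

/-! ### The `x ↦ -x` symmetry of the bank data -/

open Literature.Probability.RandomPlanarGeometry.SAW (pt pt_apply_zero pt_apply_one)

/-- The reflection `(x, y) ↦ (-x, y)` of `ℤ²`. [folklore] -/
def reflectX (v : Site 2) : Site 2 := pt (-(v 0)) (v 1)

/-- The reflection of headings under `x ↦ -x`: east ↔ west, north and south fixed (`k ↦ 2 - k`).
[folklore] -/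
def reflHeading (k : Fin 4) : Fin 4 := 2 - k

/-- `reflectX` is additive. [folklore] -/
theorem reflectX_add (v w : Site 2) : reflectX (v + w) = reflectX v + reflectX w := by
  ext i; fin_cases i
  · simp [reflectX, pt]; ring
  · simp [reflectX, pt]

/-- `reflectX` commutes with subtraction. [folklore] -/
theorem reflectX_sub (v w : Site 2) : reflectX (v - w) = reflectX v - reflectX w := by
  ext i; fin_cases i
  · simp [reflectX, pt]; ring
  · simp [reflectX, pt]

/-- `reflectX` is an involution. [folklore] -/
@[simp] theorem reflectX_reflectX (v : Site 2) : reflectX (reflectX v) = v := by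
  ext i; fin_cases i <;> simp [reflectX, pt]

/-- `reflectX` is injective. [folklore] -/
theorem reflectX_injective : Function.Injective reflectX := fun v w h => by
  simpa using congrArg reflectX h

/-- `reflectX` on the four unit vectors. [folklore] -/
theorem reflectX_cornerUnit (k : Fin 4) : reflectX (cornerUnit k) = cornerUnit (reflHeading k) := by
  fin_cases k <;> decide

/-- Headings reflect by `reflHeading`. [folklore] -/
theorem headingOf_reflectX_cornerUnit (k : Fin 4) :
    headingOf (reflectX (cornerUnit k)) = reflHeading k := by
  rw [reflectX_cornerUnit, headingOf_cornerUnit]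

/-- `arg` reflects as `θ ↦ π - θ` on the headings east, north, west (NOT south: `arg ∈ (-π, π]`).
[folklore] -/
theorem argQuarter_reflHeading {k : Fin 4} (hk : k ≠ 3) : argQuarter (reflHeading k) = 2 - argQuarter k := by
  fin_cases k <;> simp [reflHeading, argQuarter] at hk ⊢

/-- Turns change sign under reflection (no reversal). [folklore] -/
theorem qturn_reflHeading {k k' : Fin 4} (h : k' ≠ k + 2) :
    qturn (reflHeading k) (reflHeading k') = -qturn k k' := by
  fin_cases k <;> fin_cases k' <;> simp [reflHeading, qturn] at h ⊢

/-- A lattice path reflects to a lattice path. [folklore] -/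
theorem IsLatticePath.map_reflectX : ∀ {l : List (Site 2)}, IsLatticePath l → IsLatticePath (l.map reflectX)
  | [], _ => trivial
  | [_], _ => trivial
  | p :: q :: rest, ⟨⟨k, hk⟩, hrest⟩ => by
    refine ⟨⟨reflHeading k, ?_⟩, IsLatticePath.map_reflectX hrest⟩
    rw [hk, reflectX_add, reflectX_cornerUnit]

/-- The headings of a reflected lattice path are the reflected headings. [folklore] -/
theorem stepDirs_map_reflectX : ∀ {l : List (Site 2)}, IsLatticePath l →
    stepDirs (l.map reflectX) = (stepDirs l).map reflHeading
  | [], _ => rfl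
  | [_], _ => rfl
  | p :: q :: rest, ⟨⟨k, hk⟩, hrest⟩ => by
    have ih := stepDirs_map_reflectX hrest
    subst hk
    simp only [List.map_cons] at ih ⊢
    rw [stepDirs_cons_cons, stepDirs_cons_add, ← reflectX_sub, add_sub_cancel_left,
      headingOf_reflectX_cornerUnit, ih, List.map_cons]

/-- No immediate reversal in a list of headings. [folklore] -/
def NoReversal : List (Fin 4) → Prop
  | k :: k' :: ks => k' ≠ k + 2 ∧ NoReversal (k' :: ks)
  | _ => True

/-- The total turning changes sign under reflection (no reversals). [folklore] -/
theorem turnSum_map_reflHeading : ∀ {ks : List (Fin 4)}, NoReversal ks →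
    turnSum (ks.map reflHeading) = -turnSum ks
  | [], _ => by simp
  | [_], _ => by simp
  | k :: k' :: ks, ⟨h, hrest⟩ => by
    have ih := turnSum_map_reflHeading hrest
    simp only [List.map_cons] at ih ⊢
    rw [turnSum_cons_cons, turnSum_cons_cons, qturn_reflHeading h, ih]
    ring

/-- `NoReversal` is preserved by truncation. [folklore] -/
theorem NoReversal.take : ∀ {ks : List (Fin 4)} (_ : NoReversal ks) (n : ℕ), NoReversal (ks.take n)
  | [], _, n => by simp [NoReversal]
  | [k], _, n => by cases n <;> simp [NoReversal]
  | k :: k' :: ks, h, 0 => by simp [NoReversal]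
  | k :: k' :: ks, h, 1 => by simp [NoReversal]
  | k :: k' :: ks, h, n + 2 => by
    simp only [List.take_succ_cons]
    have ih := NoReversal.take h.2 (n + 1)
    simp only [List.take_succ_cons] at ih
    exact ⟨h.1, ih⟩

/-- `stepDirs` of `a :: η` has one heading per vertex of `η`. [folklore] -/
theorem length_stepDirs_cons (a : Site 2) : ∀ η : List (Site 2), (stepDirs (a :: η)).length = η.length
  | [] => rfl
  | b :: rest => by rw [stepDirs_cons_cons, List.length_cons, length_stepDirs_cons b rest, List.length_cons]

/-- **Lifted headings reflect as `θ ↦ π - θ`** (in quarter turns `q ↦ 2 - q`) for a lattice path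
without reversals whose first step does not point south. [folklore] -/
theorem pathHeadingQ_reflectX {aMinus : Site 2} {η : List (Site 2)} (hne : η ≠ [])
    (hpath : IsLatticePath (aMinus :: η)) (hrev : NoReversal (stepDirs (aMinus :: η)))
    (h0 : (stepDirs (aMinus :: η)).headD 0 ≠ 3) (j : ℕ) :
    pathHeadingQ (reflectX aMinus) (η.map reflectX) j = 2 - pathHeadingQ aMinus η j := by
  unfold pathHeadingQ
  have hs : stepDirs (reflectX aMinus :: η.map reflectX) = (stepDirs (aMinus :: η)).map reflHeading := by
    rw [← List.map_cons, stepDirs_map_reflectX hpath]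
  rw [hs, ← List.map_take, turnSum_map_reflHeading (hrev.take _)]
  cases hη : stepDirs (aMinus :: η) with
  | nil =>
    have hl := length_stepDirs_cons aMinus η
    rw [hη, List.length_nil] at hl
    exact absurd (List.length_eq_zero_iff.1 hl.symm) hne
  | cons k ks =>
    rw [hη] at h0
    simp only [List.map_cons, List.headD_cons] at h0 ⊢
    rw [argQuarter_reflHeading h0]
    ring

/-- **Lifted headings reflect as `θ ↦ π - θ`.** [folklore] -/
theorem pathHeading_reflectX {aMinus : Site 2} {η : List (Site 2)} (hne : η ≠ [])
    (hpath : IsLatticePath (aMinus :: η)) (hrev : NoReversal (stepDirs (aMinus :: η)))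
    (h0 : (stepDirs (aMinus :: η)).headD 0 ≠ 3) (j : ℕ) :
    pathHeading (reflectX aMinus) (η.map reflectX) j = π - pathHeading aMinus η j := by
  rw [pathHeading, pathHeading, pathHeadingQ_reflectX hne hpath hrev h0]
  push_cast
  ring

/-- First occurrences are preserved by the (injective) reflection. [folklore] -/
theorem idxOf_map_reflectX (w : Site 2) : ∀ (η : List (Site 2)),
    (η.map reflectX).idxOf (reflectX w) = η.idxOf w
  | [] => rfl
  | z :: rest => by
    by_cases h : z = w
    · subst h; simp
    · have h' : reflectX z ≠ reflectX w := fun e => h (reflectX_injective e)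
      rw [List.map_cons, List.idxOf_cons_ne _ h', List.idxOf_cons_ne _ h, idxOf_map_reflectX w rest]

/-- `getD` through `map reflHeading`, inside the list. [folklore] -/
theorem getD_map_reflHeading : ∀ (ks : List (Fin 4)) (n : ℕ), n < ks.length →
    (ks.map reflHeading).getD n 0 = reflHeading (ks.getD n 0)
  | [], _, h => absurd h (by simp)
  | _ :: _, 0, _ => rfl
  | _ :: ks, n + 1, h => by
    simp only [List.map_cons, List.getD_cons_succ]
    exact getD_map_reflHeading ks n (by simpa using h)

/-- `reflHeading (k + 1) = reflHeading k + 3`. [folklore] -/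
theorem reflHeading_add_one (k : Fin 4) : reflHeading (k + 1) = reflHeading k + 3 := by
  fin_cases k <;> decide

/-- **The `x ↦ -x` symmetry of the bank data, `d ↦ π - d`**: the left neighbour `w + e_{k+1}` of a
path vertex `w` entered with heading `k` reflects to the right neighbour of the reflected vertex
(entered with heading `reflHeading k`), and its datum `π - sθ` to `s(π - (π - θ)) = π - (π - sθ)`.
Hypotheses: a lattice path without reversals whose phantom first step does not point south (for a
south start `arg ∈ (-π, π]` breaks the symmetry of the anchor by `2π`). [folklore] -/
theorem bankDatum_reflectX_left (s : ℝ) {aMinus : Site 2} {η : List (Site 2)}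
    (hpath : IsLatticePath (aMinus :: η)) (hrev : NoReversal (stepDirs (aMinus :: η)))
    (h0 : (stepDirs (aMinus :: η)).headD 0 ≠ 3) {w : Site 2} (hw : w ∈ η) {k : Fin 4}
    (hk : (stepDirs (aMinus :: η)).getD (η.idxOf w) 0 = k) :
    bankDatum s (reflectX aMinus) (η.map reflectX) (reflectX (w + cornerUnit (k + 1))) (reflectX w) =
      π - bankDatum s aMinus η (w + cornerUnit (k + 1)) w := by
  have hne : η ≠ [] := List.ne_nil_of_mem hw
  have hj : η.idxOf w < (stepDirs (aMinus :: η)).length := by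
    rw [length_stepDirs_cons]; exact List.idxOf_lt_length_of_mem hw
  have hk' : (stepDirs (reflectX aMinus :: η.map reflectX)).getD ((η.map reflectX).idxOf (reflectX w)) 0 =
      reflHeading k := by
    rw [← List.map_cons, stepDirs_map_reflectX hpath, idxOf_map_reflectX, getD_map_reflHeading _ _ hj, hk]
  rw [reflectX_add, reflectX_cornerUnit, reflHeading_add_one, bankDatum_right s _ _ _ hk',
    bankDatum_left s _ _ _ hk, idxOf_map_reflectX, pathHeading_reflectX hne hpath hrev h0]
  ring

/-- **The `x ↦ -x` symmetry at the cap of the tip**: `π/2 - s(θ - π/2) ↦ π/2 - s((π - θ) - π/2)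
= π - (π/2 - s(θ - π/2))`. [folklore] -/
theorem bankDatum_reflectX_cap (s : ℝ) {aMinus : Site 2} {η : List (Site 2)}
    (hpath : IsLatticePath (aMinus :: η)) (hrev : NoReversal (stepDirs (aMinus :: η)))
    (h0 : (stepDirs (aMinus :: η)).headD 0 ≠ 3) {w : Site 2} (hw : w ∈ η) {k : Fin 4}
    (hk : (stepDirs (aMinus :: η)).getD (η.idxOf w) 0 = k) (htip : ¬ η.idxOf w + 1 < η.length) :
    bankDatum s (reflectX aMinus) (η.map reflectX) (reflectX (w + cornerUnit k)) (reflectX w) =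
      π - bankDatum s aMinus η (w + cornerUnit k) w := by
  have hne : η ≠ [] := List.ne_nil_of_mem hw
  have hj : η.idxOf w < (stepDirs (aMinus :: η)).length := by
    rw [length_stepDirs_cons]; exact List.idxOf_lt_length_of_mem hw
  have hk' : (stepDirs (reflectX aMinus :: η.map reflectX)).getD ((η.map reflectX).idxOf (reflectX w)) 0 =
      reflHeading k := by
    rw [← List.map_cons, stepDirs_map_reflectX hpath, idxOf_map_reflectX, getD_map_reflHeading _ _ hj, hk]
  have htip' : ¬ (η.map reflectX).idxOf (reflectX w) + 1 < (η.map reflectX).length := by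
    rwa [idxOf_map_reflectX, List.length_map]
  rw [reflectX_add, reflectX_cornerUnit, bankDatum_cap s _ _ _ hk' htip', bankDatum_cap s _ _ _ hk htip,
    idxOf_map_reflectX, pathHeading_reflectX hne hpath hrev h0]
  ring

end FlowLine
end Literature.Probability.RandomPlanarGeometry
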